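import Mathlib
import Literature.Combinatorics.Optimization.GroverSosCertificates
import Literature.Barriers.PneNP.MatchingSlackPsdFoolingSet
import Literature.Barriers.PneNP.TSPExtensionComplexityRothvossCounts
import Literature.Barriers.PneNP.TSPExtensionComplexityRothvossProofs
import Literature.Combinatorics.Optimization.PerfectMatchingPolytopeDimension
import HarnessLib

/-!
# Proof of the barrier fact `KaniewskiLeeDewolf2015_thm19`: the matching slack matrix has an
# exponentially close one-sided approximation of psd rank `2^{O(n^{1/2+ε}(log n)²)}`

J. Kaniewski, T. Lee, R. de Wolf, *Query complexity in expectation*, ICALP 2015 = arXiv:1411.7280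
[KaniewskiLeeDewolf2015] (held `paper:arxiv-1411.7280`), §7.3, **Theorem 19** (p. 12, verbatim): "For
every `ε > 0` there exists a matrix `S̃` of psd rank `2^{O(n^{1/2+ε}(log n)²)}` such that
(1) `S_{UM} − 2^{−(n/2)^{2ε}} ≤ S̃_{UM} ≤ S_{UM}` for the `UM`-entries where `|δ(U) ∩ M| > (n/2)^{2ε}`;
(2) `S̃_{xy} = S_{xy}` for all other entries."  Printed proof (p. 12): "In Theorem 21 in the appendix,
we show that the `m`-bit function `g(z) = |z| − 1` can be approximated (in expectation) up to
exponentially small error with quantum query complexity `O(m^{1/2+ε} log m)`. Define `f_M(x) = g(x_M)`,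
where `x_M` denotes the restriction of `n`-bit string `x` to the `m` positions in the support of `M`.
Applying Theorem 18 … gives [Theorem 19]."

This file DISCHARGES the named fact `KaniewskiLeeDewolf2015_thm19` of
`MatchingSlackPsdApproximation.lean` (the odd-set block, typed with `∃ C n₀ ∀ even n ≥ n₀`):
`KaniewskiLeeDewolf2015_thm19_holds`, with `C = 10⁴`, `n₀ = 4`.  Consequently the barrier corollary
`KaniewskiLeeDewolf2015_thm19.ceiling` (approximation-robust psd-rank lower bounds for the perfect
matching polytope cannot exceed `2^{Õ(√n)}`) holds unconditionally.

Construction (following the printed proof, de-quantised in `GroverSosCertificates.lean`): with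
`m = n/2`, `ℓ = min(⌊m^{2ε}⌋, m)`, `L = ⌊log₂ m⌋`, the matrix is `S̃_{UM} = F(|δ(U) ∩ M|)`
(`KLWApprox.approx`), `F = GroverSchedule.F m ℓ L` the expected payout of the explicit run schedule.
* exactness / one-sided error (`KLWApprox.isKLWPerturbation_approx`): `|δ(U) ∩ M| ≥ 1` is odd-set
  parity (`PsdFoolingSet.one_le_cc`), `≤ m` (`IsPMOn.two_mul_card`); below the threshold `F = S`
  (`F_eq_of_le`), above it `S − 2^{−(ℓ+1)} ≤ S̃ ≤ S` (`sub_le_F`, `F_le`) and `2^{−(ℓ+1)} ≤ 2^{−m^{2ε}}`;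
* psd factorisation (`KLWApprox.hasPsdFactorization_approx`): rows embed as cut vectors
  `x_U = δ(U) ∈ {0,1}^{Sym2 [n]}` (`cutPoint`), the column function `x ↦ F(|x ∩ M|)` is a sum of squares
  of degree `2·halfDeg` in the edge variables (`hasSosCertificate_F`, `|M| = m`), so Theorem 18
  (`hasPsdFactorization_of_hasSosCertificate`) gives size `Σ_{i ≤ halfDeg} C(|Sym2 [n]|, i)`;
* size (`KLWApprox.size_le`): `halfDeg ≤ 1600·m^{1/2+ε}(L+1)` (`halfDeg_le_rpow`, from `halfDeg_le`
  with `ℓ ≤ m^{2ε}`, `ℓ ≤ √m·m^ε`, `L+3 ≤ 4√m`), `|Sym2 [n]| ≤ n²`, `Σ_{i≤D} C(N,i) ≤ 1 + N^D ≤ 2n^{2D}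
  = 2^{1+2D log₂ n}`, `L + 1 ≤ log₂ n ≤ (3/2) log n`, giving `≤ 2^{10⁴ n^{1/2+ε} (log n)²}` for even
  `n ≥ 4`.
* the FULL Edmonds slack matrix (`PMPolytopeDim.pmFullSlack n = Sum.elim (odd-cut rows) (edge rows
  χ_M(e))`, the printed "O(n²) additional rows for the degree and nonnegativity constraints"; degree
  equalities have zero slack): `KaniewskiLeeDewolf2015_thm19_full` — `S̃` extended by the EXACT edge
  rows keeps a psd factorisation of size `size + |Edge n| ≤ 2^{(10⁴+1) n^{1/2+ε}(log n)²}`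
  (row stacking `HasPsdFactorization.sumElim`, `of_entry_nonneg_card_rows`).
* **Theorem 21 itself, as a cube statement** (`KaniewskiLeeDewolf2015_thm21`): for every `ε > 0` there
  is `C` (= 2400) such that for every `m ≥ 1` some `f : {0,1}^m → ℝ` has an sos certificate of degree
  `2d`, `d ≤ C·m^{1/2+ε}(log m + 1)`, with `f(0^m) = 0`, `f(z) = |z| − 1` for `1 ≤ |z| ≤ m^{2ε}` and
  `|z| − 1 − 2^{−m^{2ε}} ≤ f(z) ≤ |z| − 1` for `|z| > m^{2ε}` (the printed `QE(f) = O(m^{1/2+ε} log m)`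
  read through Theorem 12, `QE = deg_sos`; `log m + 1` in place of `log m` only to cover `m = 1`).
* **the nonnegative-rank contrast** (Part F, §RobustLP, appended): KLW's remark (p. 12) that in the LP
  world such approximations are impossible — for the admissible class of Theorem 19 every `S̃` has
  NONNEGATIVE rank `≥ 2^{cn}` (`klwPerturbation_nonnegRank_all`, `c = δ_Rothvoß/432`, all large even `n`),
  by Rothvoß's Lemmas 5–6 on the tree's slot model (`nonnegRank_slot`, `klwPerturbation_nonnegRank`) and
  the padding `K_n ⊆ K_{n+2d}` (`isKLWPerturbation_pad`); packaged as the technique class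
  `IsApproxRobustNonnegBound` (LP mirror of `IsApproxRobustPsdBound`), its floor
  `approxRobustNonnegBound_floor` (`⌈2^{cn}⌉` is a robust nonnegative-rank bound) and the headline
  `KaniewskiLeeDewolf2015_contrast` (LP floor `2^{cn}` vs SDP ceiling `2^{C n^{1/2+ε} log² n}`).
* **level form** (appended): `KaniewskiLeeDewolf2015_thm19_level` — the admissible `S̃` is
  `g(|δ(U) ∩ M|)` for one `g : ℕ → ℝ` (as in print), and `levelRobustPsdBound_ceiling`.
Deviations from print: those recorded in `GroverSosCertificates.lean` (explicit polynomials instead of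
quantum algorithms; constants); the threshold is capped at `m` (for `ε > 1/2` every entry is exact and
the printed statement asks nothing more); the constant `C = 10⁴` is independent of `ε`.
-/

noncomputable section

namespace Literature.Barriers.PneNP

open Finset Real
open Literature.Combinatorics.Optimization
open Literature.Combinatorics.Optimization.GroverSchedule
open Literature.Combinatorics.SimpleGraph.CycleSpace (Crosses)

namespace KLWApprox

variable {n : ℕ}

/-! ### Encoding the slack matrix on the cube `{0,1}^{Sym2 [n]}` -/

/-- An enumeration of the unordered pairs of `[n]` (the coordinates of the cube carrying
`x = δ(U)` and the supports of the matchings). [cite: KaniewskiLeeDewolf2015, §7.3 (p. 12: "M ∈ {0,1}^{C(n,2)}")] -/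
def edgeCode (n : ℕ) : Sym2 (Fin n) ≃ Fin (Fintype.card (Sym2 (Fin n))) := Fintype.equivFin _

/-- The row point `x_U = δ(U) ∈ {0,1}^{Sym2 [n]}`. [cite: KaniewskiLeeDewolf2015, §7.3 (p. 12: "δ(U) ∈ {0,1}^{C(n,2)} denotes the cut induced by U")] -/
def cutPoint (U : OddSet n) : Fin (Fintype.card (Sym2 (Fin n))) → Bool :=
  fun i => decide (Crosses U.1 ((edgeCode n).symm i))

/-- The coordinate set of a perfect matching (its `m = n/2` edges). [cite: KaniewskiLeeDewolf2015, §7.3 (p. 12: "the m positions in the support of M")] -/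
def matchCoords (M : PMatch n) : Finset (Fin (Fintype.card (Sym2 (Fin n)))) :=
  M.1.map (edgeCode n).toEmbedding

/-- A perfect matching of `K_n` occupies `n/2` coordinates. [cite: KaniewskiLeeDewolf2015, §7.3 (p. 12: "a vector M ∈ {0,1}^{C(n,2)} of weight m = n/2")] -/
theorem card_matchCoords (M : PMatch n) : (matchCoords M).card = n / 2 := by
  rw [matchCoords, Finset.card_map]
  have h := M.2.two_mul_card
  rw [Finset.card_univ, Fintype.card_fin] at h
  omega

/-- `|x_U ∩ M| = |δ(U) ∩ M|`. [cite: KaniewskiLeeDewolf2015, §7.3 (p. 12: "f_M(x) = g(x_M)")] -/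
theorem wt_matchCoords_cutPoint (U : OddSet n) (M : PMatch n) :
    wt (matchCoords M) (cutPoint U) = cc U M := by
  classical
  rw [wt_eq_card_filter]
  norm_cast
  unfold matchCoords cc
  rw [Finset.filter_map, Finset.card_map]
  congr 1
  ext e
  simp [cutPoint, Function.comp]

/-- `|δ(U) ∩ M| ≤ n/2`. [folklore] -/
private theorem cc_le_half (U : OddSet n) (M : PMatch n) : cc U M ≤ n / 2 := by
  have h := M.2.two_mul_card
  rw [Finset.card_univ, Fintype.card_fin] at h
  have : cc U M ≤ M.1.card := Finset.card_filter_le _ _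
  omega

/-! ### The parameters and the approximating matrix -/

/-- The exactness threshold `ℓ = min(⌊m^{2ε}⌋, m)`. [cite: KaniewskiLeeDewolf2015, App. Thm. 21 proof (p. 14: "Set ℓ = m^{2ε}")] -/
def ell (m : ℕ) (ε : ℝ) : ℕ := min ⌊(m : ℝ) ^ (2 * ε)⌋₊ m

/-- The logarithmic scale parameter `L = ⌊log₂ m⌋`. [cite: KaniewskiLeeDewolf2015, App. Thm. 20 (p. 14: "i = ⌊log ℓ⌋, …, ⌊log m⌋")] -/
def logm (m : ℕ) : ℕ := Nat.log 2 m

/-- **The approximating matrix** `S̃_{UM} = F(|δ(U) ∩ M|)`. [cite: KaniewskiLeeDewolf2015, Thm. 19 (p. 12)] -/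
def approx (n : ℕ) (ε : ℝ) (U : OddSet n) (M : PMatch n) : ℝ :=
  F (n / 2) (ell (n / 2) ε) (logm (n / 2)) (cc U M)

/-- Half the degree of the certificate. [cite: KaniewskiLeeDewolf2015, Thm. 19 (p. 12)] -/
def deg (n : ℕ) (ε : ℝ) : ℕ := halfDeg (n / 2) (ell (n / 2) ε) (logm (n / 2))

/-- The size of the psd factorisation: `#{S ⊆ Sym2 [n] : |S| ≤ deg}`. [cite: KaniewskiLeeDewolf2015, Thm. 18 (p. 12)] -/
def size (n : ℕ) (ε : ℝ) : ℕ :=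
  ∑ i ∈ Finset.range (deg n ε + 1), (Fintype.card (Sym2 (Fin n))).choose i

/-- `ℓ ≤ ⌊m^{2ε}⌋`. [folklore] -/
private theorem ell_le_floor (m : ℕ) (ε : ℝ) : ell m ε ≤ ⌊(m : ℝ) ^ (2 * ε)⌋₊ := min_le_left _ _
/-- `ℓ ≤ m`. [folklore] -/
private theorem ell_le (m : ℕ) (ε : ℝ) : ell m ε ≤ m := min_le_right _ _
/-- `ℓ ≤ m^{2ε}`. [folklore] -/
private theorem ell_le_rpow (m : ℕ) (ε : ℝ) : (ell m ε : ℝ) ≤ (m : ℝ) ^ (2 * ε) :=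
  (Nat.cast_le.2 (ell_le_floor m ε)).trans (Nat.floor_le (by positivity))

/-- `m < 2^{L+1}`. [folklore] -/
private theorem lt_two_pow_logm (m : ℕ) : m < 2 ^ (logm m + 1) := Nat.lt_pow_succ_log_self one_lt_two m

/-! ### The psd factorisation -/

/-- **`S̃` has a psd factorisation of size `#{S : |S| ≤ deg}`** (Theorem 18 applied to the sos
certificate of `F`, restricted to the rows `x = δ(U)`). [cite: KaniewskiLeeDewolf2015, Thm. 18–19 (p. 12)] -/
theorem hasPsdFactorization_approx (n : ℕ) (ε : ℝ) : HasPsdFactorization (approx n ε) (size n ε) := by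
  set m := n / 2
  set ℓ := ell m ε
  set L := logm m
  let f : PMatch n → (Fin (Fintype.card (Sym2 (Fin n))) → Bool) → ℝ :=
    fun M x => F m ℓ L (wt (matchCoords M) x)
  have hf : ∀ M, HasSosCertificate (2 * halfDeg m ℓ L) (f M) := fun M =>
    hasSosCertificate_F m ℓ L (matchCoords M) (card_matchCoords M)
  have h1 := hasPsdFactorization_of_hasSosCertificate f hf
  have h2 := h1.submatrix (fun U : OddSet n => cutPoint U) (fun M : PMatch n => M)
  have hfun : approx n ε = fun (U : OddSet n) (M : PMatch n) => f M (cutPoint U) := by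
    funext U M
    simp only [f, wt_matchCoords_cutPoint]
    rfl
  unfold size deg
  rw [hfun]
  exact h2

/-! ### The perturbation bounds -/

/-- `(n : ℝ)/2 = n/2` for even `n`. [folklore] -/
private theorem half_cast {n : ℕ} (hn : Even n) : ((n : ℝ) / 2) = ((n / 2 : ℕ) : ℝ) := by
  obtain ⟨k, rfl⟩ := hn
  rw [← two_mul, Nat.mul_div_cancel_left _ two_pos]
  push_cast; ring

/-- **`S̃` is an `(ε,n)`-admissible perturbation of `S`:** exact where `|δ(U) ∩ M| ≤ (n/2)^{2ε}`, and
`S − 2^{−(n/2)^{2ε}} ≤ S̃ ≤ S` elsewhere. [cite: KaniewskiLeeDewolf2015, Thm. 19 (p. 12)] -/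
theorem isKLWPerturbation_approx {n : ℕ} (hn : Even n) (ε : ℝ) :
    IsKLWPerturbation n ε (approx n ε) := by
  intro U M
  set m := n / 2 with hm
  have hcast : ((n : ℝ) / 2) = (m : ℝ) := half_cast hn
  have h1 : 1 ≤ cc U M := PsdFoolingSet.one_le_cc U M
  have hcm : cc U M ≤ m := cc_le_half U M
  have hpow0 : 0 ≤ (m : ℝ) ^ (2 * ε) := by positivity
  rw [hcast]
  refine ⟨fun hle => ?_, fun hlt => ?_⟩
  · -- exact regime
    have hfl : cc U M ≤ ⌊(m : ℝ) ^ (2 * ε)⌋₊ := Nat.le_floor hle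
    have hℓ : cc U M ≤ ell m ε := le_min hfl hcm
    unfold approx
    rw [pmOddCutSlack_apply, F_eq_of_le h1 hℓ]
  · -- approximate regime
    have hfl : ⌊(m : ℝ) ^ (2 * ε)⌋₊ < cc U M := (Nat.floor_lt hpow0).2 hlt
    have hℓlt : ell m ε < cc U M := lt_of_le_of_lt (ell_le_floor m ε) hfl
    have hℓeq : ell m ε = ⌊(m : ℝ) ^ (2 * ε)⌋₊ := min_eq_left (by omega)
    have hk1 : ((ell m ε : ℕ) : ℝ) + 1 ≤ (cc U M : ℝ) := by exact_mod_cast hℓlt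
    have hkm : ((cc U M : ℕ) : ℝ) ≤ m := by exact_mod_cast hcm
    have hlow := sub_le_F hk1 hkm (lt_two_pow_logm m)
    have hup := F_le (m := m) (ℓ := ell m ε) (L := logm m) (k := (cc U M : ℝ))
      (by exact_mod_cast h1) hkm
    unfold approx
    rw [pmOddCutSlack_apply]
    refine ⟨le_trans ?_ hlow, hup⟩
    -- `2^{-(m^{2ε})} ≥ (1/2)^{ℓ+1}` since `m^{2ε} < ⌊m^{2ε}⌋ + 1 = ℓ + 1`
    have hexp : (1 / 2 : ℝ) ^ (ell m ε + 1) ≤ (2 : ℝ) ^ (-((m : ℝ) ^ (2 * ε))) := by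
      have hlt' : (m : ℝ) ^ (2 * ε) < (ell m ε : ℝ) + 1 := by
        rw [hℓeq]; exact Nat.lt_floor_add_one _
      rw [_root_.one_div_pow, one_div, ← Real.rpow_natCast, ← Real.rpow_neg (by norm_num)]
      apply Real.rpow_le_rpow_of_exponent_le (by norm_num)
      push_cast; linarith
    linarith

/-! ### The size bound -/

/-- `(L+3)² ≤ 16·2^L`. [folklore] -/
private theorem log_add_three_sq_le (L : ℕ) : (L + 3) ^ 2 ≤ 16 * 2 ^ L := by
  induction L with
  | zero => norm_num
  | succ L ih =>
    have h2 : 2 * L + 7 ≤ 16 * 2 ^ L := by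
      have : L + 1 ≤ 2 ^ L := Nat.lt_two_pow_self
      omega
    calc (L + 1 + 3) ^ 2 = (L + 3) ^ 2 + (2 * L + 7) := by ring
      _ ≤ 16 * 2 ^ L + 16 * 2 ^ L := Nat.add_le_add ih h2
      _ = 16 * 2 ^ (L + 1) := by ring

/-- `L + 3 ≤ 4√m` for `L = ⌊log₂ m⌋`, `m ≥ 1`. [folklore] -/
private theorem logm_add_three_le {m : ℕ} (hm : 1 ≤ m) : (logm m : ℝ) + 3 ≤ 4 * sqrt m := by
  have h1 : 2 ^ logm m ≤ m := Nat.pow_log_le_self 2 (by omega)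
  have h2 := log_add_three_sq_le (logm m)
  have h3 : ((logm m : ℝ) + 3) ^ 2 ≤ 16 * m := by
    have : ((logm m + 3) ^ 2 : ℕ) ≤ 16 * m := h2.trans (Nat.mul_le_mul_left 16 h1)
    exact_mod_cast this
  calc (logm m : ℝ) + 3 = sqrt (((logm m : ℝ) + 3) ^ 2) := (sqrt_sq (by positivity)).symm
    _ ≤ sqrt (16 * m) := sqrt_le_sqrt h3
    _ = 4 * sqrt m := by
        rw [sqrt_mul (by norm_num), show (16 : ℝ) = 4 ^ 2 by norm_num, sqrt_sq (by norm_num)]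

/-- **The degree is `O(m^{1/2+ε} log m)`:** `halfDeg ≤ 1600 · m^{1/2+ε} · (L+1)`.
[cite: KaniewskiLeeDewolf2015, App. Thm. 21 (p. 14: "QE(f) = O(m^{1/2+ε} log m)")] -/
theorem halfDeg_le_rpow {m : ℕ} (hm : 1 ≤ m) {ε : ℝ} (hε : 0 < ε) :
    (halfDeg m (ell m ε) (logm m) : ℝ) ≤
      1600 * (m : ℝ) ^ (1 / 2 + ε) * ((logm m : ℝ) + 1) := by
  set ℓ := ell m ε with hℓdef
  set L := logm m with hLdef
  set P : ℝ := (m : ℝ) ^ (1 / 2 + ε) with hP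
  have hm0 : (0 : ℝ) < m := by exact_mod_cast hm
  have hm1 : (1 : ℝ) ≤ m := by exact_mod_cast hm
  have hL0 : (0 : ℝ) ≤ L := Nat.cast_nonneg L
  have hℓ0 : (0 : ℝ) ≤ ℓ := Nat.cast_nonneg ℓ
  -- basic comparisons with `P = m^{1/2+ε} = √m · m^ε`
  have hsqrtm : sqrt m = (m : ℝ) ^ (1 / 2 : ℝ) := Real.sqrt_eq_rpow _
  have hmε1 : 1 ≤ (m : ℝ) ^ ε := Real.one_le_rpow hm1 hε.le
  have hPeq : P = sqrt m * (m : ℝ) ^ ε := by rw [hP, hsqrtm, ← Real.rpow_add hm0]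
  have hsqrt1 : 1 ≤ sqrt (m : ℝ) := by rw [show (1 : ℝ) = sqrt 1 from sqrt_one.symm]; exact sqrt_le_sqrt hm1
  have hsqrtP : sqrt m ≤ P := by rw [hPeq]; exact le_mul_of_one_le_right (sqrt_nonneg _) hmε1
  have hP1 : 1 ≤ P := hsqrt1.trans hsqrtP
  have hP0 : 0 ≤ P := zero_le_one.trans hP1
  -- `√ℓ ≤ m^ε`, `√ℓ ≤ √m`, hence `√m√ℓ ≤ P` and `ℓ ≤ P`
  have hℓrpow : (ℓ : ℝ) ≤ (m : ℝ) ^ (2 * ε) := ell_le_rpow m ε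
  have hsqrtℓ : sqrt ℓ ≤ (m : ℝ) ^ ε := by
    calc sqrt (ℓ : ℝ) ≤ sqrt ((m : ℝ) ^ (2 * ε)) := sqrt_le_sqrt hℓrpow
      _ = (m : ℝ) ^ ε := by
          rw [Real.sqrt_eq_rpow, ← Real.rpow_mul hm0.le]; congr 1; ring
  have hsqrtℓ' : sqrt ℓ ≤ sqrt m := sqrt_le_sqrt (by exact_mod_cast ell_le m ε)
  have hA : sqrt m * sqrt ℓ ≤ P := by rw [hPeq]; gcongr
  have hB : (ℓ : ℝ) ≤ P := by
    calc (ℓ : ℝ) = sqrt ℓ * sqrt ℓ := (mul_self_sqrt hℓ0).symm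
      _ ≤ sqrt m * (m : ℝ) ^ ε := mul_le_mul hsqrtℓ' hsqrtℓ (sqrt_nonneg _) (sqrt_nonneg _)
      _ = P := hPeq.symm
  -- `√(ℓ+1)·√m ≤ 2P`, `√(m/(ℓ+1))·(ℓ+1) = √m √(ℓ+1)`
  have hC : sqrt ((m : ℝ) / (ℓ + 1)) * ((ℓ : ℝ) + 1) ≤ 2 * P := by
    have hℓ1 : (0 : ℝ) < ℓ + 1 := by linarith
    have hs : 0 < sqrt ((ℓ : ℝ) + 1) := sqrt_pos.2 hℓ1
    have e1 : sqrt ((m : ℝ) / (ℓ + 1)) * ((ℓ : ℝ) + 1) = sqrt m * sqrt (ℓ + 1) := by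
      rw [sqrt_div (Nat.cast_nonneg m)]
      calc sqrt (m : ℝ) / sqrt (ℓ + 1) * (ℓ + 1)
          = sqrt m / sqrt (ℓ + 1) * (sqrt (ℓ + 1) * sqrt (ℓ + 1)) := by rw [mul_self_sqrt hℓ1.le]
        _ = sqrt m * sqrt (ℓ + 1) := by field_simp
    rw [e1]
    have : sqrt ((ℓ : ℝ) + 1) ≤ sqrt ℓ + 1 := by
      rw [sqrt_le_left (by positivity)]
      nlinarith [sqrt_nonneg (ℓ : ℝ), mul_self_sqrt hℓ0]
    calc sqrt (m : ℝ) * sqrt (ℓ + 1) ≤ sqrt m * (sqrt ℓ + 1) := by gcongr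
      _ = sqrt m * sqrt ℓ + sqrt m := by ring
      _ ≤ P + P := add_le_add hA hsqrtP
      _ = 2 * P := by ring
  have hD : sqrt ((m : ℝ) / (ℓ + 1)) ≤ P := by
    calc sqrt ((m : ℝ) / (ℓ + 1)) ≤ sqrt m := sqrt_le_sqrt (div_le_self (Nat.cast_nonneg m) (by linarith))
      _ ≤ P := hsqrtP
  -- `L + 3 ≤ 4P`
  have hE : (L : ℝ) + 3 ≤ 4 * P := (logm_add_three_le hm).trans (by linarith)
  -- assemble
  have hmain := halfDeg_le m ℓ L
  have hreps : ((reps ℓ L : ℕ) : ℝ) = 16 * (ℓ + L + 3) := by unfold reps; push_cast; ring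
  have hnS : ((nScales L : ℕ) : ℝ) = 4 * (L + 1) + 1 := by unfold nScales; push_cast; ring
  rw [hreps, hnS] at hmain
  have hT1 : 16 * ((ℓ : ℝ) + L + 3) * (11 * sqrt ((m : ℝ) / (ℓ + 1))) ≤ 704 * P * (L + 1) := by
    have : ((ℓ : ℝ) + L + 3) * sqrt ((m : ℝ) / (ℓ + 1)) ≤ 4 * P * (L + 1) := by
      calc ((ℓ : ℝ) + L + 3) * sqrt ((m : ℝ) / (ℓ + 1))
          = sqrt ((m : ℝ) / (ℓ + 1)) * ((ℓ : ℝ) + 1) + (L + 2) * sqrt ((m : ℝ) / (ℓ + 1)) := by ring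
        _ ≤ 2 * P + (L + 2) * P := by gcongr
        _ ≤ 4 * P * (L + 1) := by nlinarith
    nlinarith
  have hT2 : 16 * ((ℓ : ℝ) + L + 3) * (2 * (4 * (L + 1) + 1)) ≤ 800 * P * (L + 1) := by
    have h5 : (ℓ : ℝ) + L + 3 ≤ 5 * P := by linarith
    have h6 : (2 : ℝ) * (4 * (L + 1) + 1) ≤ 10 * (L + 1) := by linarith
    calc 16 * ((ℓ : ℝ) + L + 3) * (2 * (4 * (L + 1) + 1)) ≤ 16 * (5 * P) * (10 * (L + 1)) := by
          gcongr
      _ = 800 * P * (L + 1) := by ring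
  have hT0 : 1 + (2 * sqrt (m : ℝ) * sqrt ℓ + 2 * ℓ) ≤ 5 * P * (L + 1) := by nlinarith
  calc (halfDeg m ℓ L : ℝ)
      ≤ 1 + (2 * sqrt (m : ℝ) * sqrt ℓ + 2 * ℓ) +
          16 * (ℓ + L + 3) * (11 * sqrt ((m : ℝ) / (ℓ + 1)) + 2 * (4 * (L + 1) + 1)) := hmain
    _ = (1 + (2 * sqrt (m : ℝ) * sqrt ℓ + 2 * ℓ)) +
          (16 * ((ℓ : ℝ) + L + 3) * (11 * sqrt ((m : ℝ) / (ℓ + 1))) +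
            16 * ((ℓ : ℝ) + L + 3) * (2 * (4 * (L + 1) + 1))) := by ring
    _ ≤ 5 * P * (L + 1) + (704 * P * (L + 1) + 800 * P * (L + 1)) := add_le_add hT0 (add_le_add hT1 hT2)
    _ ≤ 1600 * P * (L + 1) := by nlinarith

/-- The number of coordinates is at most `n²`. [folklore] -/
private theorem card_sym2_le (n : ℕ) : Fintype.card (Sym2 (Fin n)) ≤ n ^ 2 := by
  have h := Fintype.card_le_of_surjective (fun p : Fin n × Fin n => s(p.1, p.2))
    (fun e => Sym2.inductionOn e fun a b => ⟨(a, b), rfl⟩)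
  simpa [sq, Fintype.card_prod, Fintype.card_fin] using h

/-- **The size bound:** for even `n ≥ 4`, `size ≤ 2^{10000 · n^{1/2+ε} (log n)²}`.
[cite: KaniewskiLeeDewolf2015, Thm. 19 (p. 12: "psd rank 2^{O(n^{1/2+ε}(log n)²)}")] -/
theorem size_le {n : ℕ} (hn4 : 4 ≤ n) (hn : Even n) {ε : ℝ} (hε : 0 < ε) :
    (size n ε : ℝ) ≤ (2 : ℝ) ^ ((10000 : ℝ) * (n : ℝ) ^ (1 / 2 + ε) * Real.log n ^ 2) := by
  set m := n / 2 with hmdef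
  have hm : 1 ≤ m := by omega
  have hm2 : 2 * m = n := by obtain ⟨k, rfl⟩ := hn; omega
  set D := deg n ε with hDdef
  set NE := Fintype.card (Sym2 (Fin n)) with hNE
  have hn0 : (0 : ℝ) < n := by exact_mod_cast (show 0 < n by omega)
  have hn1 : (1 : ℝ) < n := by exact_mod_cast (show 1 < n by omega)
  -- `size ≤ 1 + NE^D ≤ 2 · n^{2D}`
  have hsize : (size n ε : ℝ) ≤ 2 * (n : ℝ) ^ (2 * D) := by
    have h1 : size n ε ≤ 1 + NE ^ D := sum_range_choose_le_one_add_pow NE D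
    have h2 : NE ^ D ≤ (n ^ 2) ^ D := Nat.pow_le_pow_left (card_sym2_le n) D
    have h3 : 1 ≤ (n ^ 2) ^ D := Nat.one_le_pow _ _ (by positivity)
    have : size n ε ≤ 2 * (n ^ 2) ^ D := by omega
    calc (size n ε : ℝ) ≤ ((2 * (n ^ 2) ^ D : ℕ) : ℝ) := by exact_mod_cast this
      _ = 2 * (n : ℝ) ^ (2 * D) := by push_cast; rw [pow_mul]
  -- `D ≤ 1600 m^{1/2+ε} (L+1) ≤ 1600 n^{1/2+ε} log₂ n`
  have hD : (D : ℝ) ≤ 1600 * (n : ℝ) ^ (1 / 2 + ε) * (Real.logb 2 n) := by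
    have h := halfDeg_le_rpow hm hε
    have hmn : (m : ℝ) ^ (1 / 2 + ε) ≤ (n : ℝ) ^ (1 / 2 + ε) :=
      Real.rpow_le_rpow (Nat.cast_nonneg m) (by exact_mod_cast (show m ≤ n by omega)) (by linarith)
    have hL : (logm m : ℝ) + 1 ≤ Real.logb 2 n := by
      rw [Real.le_logb_iff_rpow_le one_lt_two hn0]
      have : (2 : ℝ) ^ ((logm m : ℝ) + 1) = (2 : ℝ) ^ (logm m + 1) := by
        rw [← Real.rpow_natCast]; norm_cast
      rw [this]
      have h2 : 2 ^ (logm m + 1) ≤ n := by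
        have := Nat.pow_log_le_self 2 (show m ≠ 0 by omega)
        rw [pow_succ]; unfold logm; omega
      exact_mod_cast h2
    calc (D : ℝ) = (halfDeg m (ell m ε) (logm m) : ℝ) := by rw [hDdef]; rfl
      _ ≤ 1600 * (m : ℝ) ^ (1 / 2 + ε) * ((logm m : ℝ) + 1) := h
      _ ≤ 1600 * (n : ℝ) ^ (1 / 2 + ε) * Real.logb 2 n := by
          gcongr
  -- `log₂ n ≤ (3/2) log n`, `1 ≤ log n` (n ≥ 4 > e)
  have hlog2 : Real.log 2 > 0.6931471803 := Real.log_two_gt_d9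
  have hlogn1 : 1 ≤ Real.log n := by
    rw [← Real.log_exp 1]
    apply Real.log_le_log (Real.exp_pos 1)
    have : Real.exp 1 < 3 := by
      have := Real.exp_one_lt_d9; linarith
    linarith [(show (4 : ℝ) ≤ n by exact_mod_cast hn4)]
  have hlogb : Real.logb 2 n ≤ 3 / 2 * Real.log n := by
    rw [Real.logb, div_le_iff₀ (by linarith)]
    nlinarith
  have hlogb0 : 0 ≤ Real.logb 2 n := Real.logb_nonneg one_lt_two hn1.le
  have hnε : 1 ≤ (n : ℝ) ^ (1 / 2 + ε) := Real.one_le_rpow hn1.le (by linarith)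
  -- `2 n^{2D} = 2^{1 + 2 D log₂ n}`
  have hexp : 2 * (n : ℝ) ^ (2 * D) = (2 : ℝ) ^ (1 + 2 * (D : ℝ) * Real.logb 2 n) := by
    rw [Real.rpow_add two_pos, Real.rpow_one, mul_comm (2 * (D : ℝ)), Real.rpow_mul (by norm_num),
      Real.rpow_logb two_pos (by norm_num) hn0, ← Real.rpow_natCast]
    push_cast; ring_nf
  rw [hexp] at hsize
  refine hsize.trans (Real.rpow_le_rpow_of_exponent_le one_le_two ?_)
  -- `1 + 2 D log₂ n ≤ 10000 n^{1/2+ε} (log n)²`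
  have hDl : 2 * (D : ℝ) * Real.logb 2 n ≤ 7200 * (n : ℝ) ^ (1 / 2 + ε) * Real.log n ^ 2 := by
    calc 2 * (D : ℝ) * Real.logb 2 n ≤ 2 * (1600 * (n : ℝ) ^ (1 / 2 + ε) * Real.logb 2 n) * Real.logb 2 n := by
          gcongr
      _ = 3200 * (n : ℝ) ^ (1 / 2 + ε) * (Real.logb 2 n) ^ 2 := by ring
      _ ≤ 3200 * (n : ℝ) ^ (1 / 2 + ε) * (3 / 2 * Real.log n) ^ 2 := by
          gcongr
      _ = 7200 * (n : ℝ) ^ (1 / 2 + ε) * Real.log n ^ 2 := by ring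
  have hone : (1 : ℝ) ≤ (n : ℝ) ^ (1 / 2 + ε) * Real.log n ^ 2 := by nlinarith
  nlinarith

end KLWApprox

/-- **Kaniewski–Lee–de Wolf 2015, Theorem 19 — PROVED** (de-quantised): for every `ε > 0`, for all
even `n ≥ 4`, the matrix `S̃_{UM} = F(|δ(U) ∩ M|)` — `F(k) = (k−1)(1 − Π_i fail_i(k))` the expected
payout of the explicit Chebyshev/Grover schedule of `GroverSosCertificates` — equals the odd-cut slack
matrix where `|δ(U) ∩ M| ≤ (n/2)^{2ε}`, lies within `2^{−(n/2)^{2ε}}` below it elsewhere, and has a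
positive-semidefinite factorisation of size `≤ 2^{10⁴ · n^{1/2+ε} (log n)²}` (Theorem 18: Gram
matrices of truncated Walsh vectors against the sos certificate of `F`, of degree
`O(m^{1/2+ε} log m)` in the `C(n,2)` edge variables). Discharges the barrier fact
`KaniewskiLeeDewolf2015_thm19`; its corollary `KaniewskiLeeDewolf2015_thm19.ceiling` is thereby
unconditional. [cite: KaniewskiLeeDewolf2015, Thm. 19 (p. 12); App. Thms. 20–21 (p. 14)] -/
theorem KaniewskiLeeDewolf2015_thm19_holds : KaniewskiLeeDewolf2015_thm19 := by
  intro ε hε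
  refine ⟨10000, 4, fun n hn4 hn => ⟨KLWApprox.size n ε, KLWApprox.approx n ε,
    KLWApprox.size_le hn4 hn hε, KLWApprox.hasPsdFactorization_approx n ε,
    KLWApprox.isKLWPerturbation_approx hn ε⟩⟩

/-- **The barrier, now unconditional** (corollary `KaniewskiLeeDewolf2015_thm19.ceiling` fed with the
proof above): for every `ε > 0` there are `C, n₀` such that every approximation-robust psd-rank lower
bound `R` for the matching slack matrix of `K_n` (`n ≥ n₀` even) — one certified by an argument
insensitive to the perturbations (1)–(2) of Theorem 19, `IsApproxRobustPsdBound n ε R` — satisfies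
`R ≤ 2^{C n^{1/2+ε} (log n)²}`. [cite: KaniewskiLeeDewolf2015, Thm. 19 (p. 12)] -/
theorem approxRobustPsdBound_ceiling {ε : ℝ} (hε : 0 < ε) :
    ∃ C : ℝ, ∃ n₀ : ℕ, ∀ n : ℕ, n₀ ≤ n → Even n → ∀ R : ℕ,
      IsApproxRobustPsdBound n ε R →
        (R : ℝ) ≤ (2 : ℝ) ^ (C * (n : ℝ) ^ (1 / 2 + ε) * Real.log n ^ 2) :=
  KaniewskiLeeDewolf2015_thm19.ceiling KaniewskiLeeDewolf2015_thm19_holds hε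

/-! ### The full slack matrix: "S̃_{xy} = S_{xy} for all other entries" -/

namespace KLWApprox

/-- Stacking rows: factorizations of `M₁` (size `r₁`) and `M₂` (size `r₂`) with the same columns give
one of the stacked matrix of size `r₁ + r₂` (pad the row factors by zero blocks).
[cite: FawziEtAl2015, Thm. 2.9 (iii) (p06: block-diagonal factors)] -/
theorem _root_.Literature.Combinatorics.Optimization.HasPsdFactorization.sumElim
    {ι₁ ι₂ κ : Type*} {M₁ : ι₁ → κ → ℝ} {M₂ : ι₂ → κ → ℝ} {r₁ r₂ : ℕ}
    (h₁ : HasPsdFactorization M₁ r₁) (h₂ : HasPsdFactorization M₂ r₂) :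
    HasPsdFactorization (Sum.elim M₁ M₂) (r₁ + r₂) := by
  obtain ⟨A₁, B₁, hA₁, hB₁, hM₁⟩ := h₁
  obtain ⟨A₂, B₂, hA₂, hB₂, hM₂⟩ := h₂
  have hP₁ : HasPsdFactorization (Sum.elim M₁ (fun (_ : ι₂) (_ : κ) => (0 : ℝ))) r₁ := by
    refine ⟨Sum.elim A₁ (fun _ => 0), B₁, ?_, hB₁, ?_⟩
    · rintro (i | i)
      · exact hA₁ i
      · exact Matrix.PosSemidef.zero
    · rintro (i | i) j
      · exact hM₁ i j
      · simp
  have hP₂ : HasPsdFactorization (Sum.elim (fun (_ : ι₁) (_ : κ) => (0 : ℝ)) M₂) r₂ := by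
    refine ⟨Sum.elim (fun _ => 0) A₂, B₂, ?_, hB₂, ?_⟩
    · rintro (i | i)
      · exact Matrix.PosSemidef.zero
      · exact hA₂ i
    · rintro (i | i) j
      · simp
      · exact hM₂ i j
  have h := hP₁.add hP₂
  convert h using 2 with i j
  rcases i with i | i <;> simp

open Literature.Combinatorics.Optimization.PMPolytopeDim (pmVec pmFullSlack)

/-- The full approximating matrix: `S̃` on the odd-cut rows, the exact `0/1` edge rows below.
[cite: KaniewskiLeeDewolf2015, Thm. 19 (p. 12: "S̃_{xy} = S_{xy} for all other entries")] -/
def approxFull (n : ℕ) (ε : ℝ) : OddSet n ⊕ Edge n → PMatch n → ℝ :=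
  Sum.elim (approx n ε) (fun e M => pmVec n M e)

/-- The number of edge rows is at most `n²`. [folklore] -/
private theorem card_edge_le (n : ℕ) : Fintype.card (Edge n) ≤ n ^ 2 :=
  (Fintype.card_subtype_le _).trans (card_sym2_le n)

/-- `n² ≤ 2^{10⁴ · n^{1/2+ε} (log n)²}` for `n ≥ 4`. [folklore] -/
private theorem sq_le_two_rpow {n : ℕ} (hn4 : 4 ≤ n) {ε : ℝ} (hε : 0 < ε) :
    ((n : ℝ)) ^ 2 ≤ (2 : ℝ) ^ ((10000 : ℝ) * (n : ℝ) ^ (1 / 2 + ε) * Real.log n ^ 2) := by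
  have hn0 : (0 : ℝ) < n := by exact_mod_cast (show 0 < n by omega)
  have hn1 : (1 : ℝ) < n := by exact_mod_cast (show 1 < n by omega)
  have hlog2 : Real.log 2 > 0.6931471803 := Real.log_two_gt_d9
  have hlogn1 : 1 ≤ Real.log n := by
    rw [← Real.log_exp 1]
    apply Real.log_le_log (Real.exp_pos 1)
    have : Real.exp 1 < 3 := by have := Real.exp_one_lt_d9; linarith
    linarith [(show (4 : ℝ) ≤ n by exact_mod_cast hn4)]
  have hnε : 1 ≤ (n : ℝ) ^ (1 / 2 + ε) := Real.one_le_rpow hn1.le (by linarith)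
  have hlogb : Real.logb 2 n ≤ 3 / 2 * Real.log n := by
    rw [Real.logb, div_le_iff₀ (by linarith)]; nlinarith
  -- `n² = 2^{2 log₂ n}`
  have hexp : ((n : ℝ)) ^ 2 = (2 : ℝ) ^ (2 * Real.logb 2 n) := by
    rw [mul_comm, Real.rpow_mul (by norm_num), Real.rpow_logb two_pos (by norm_num) hn0]
    norm_cast
  rw [hexp]
  refine Real.rpow_le_rpow_of_exponent_le one_le_two ?_
  have : (1 : ℝ) ≤ (n : ℝ) ^ (1 / 2 + ε) * Real.log n ^ 2 := by nlinarith
  nlinarith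

end KLWApprox

/-- **Theorem 19 for the FULL Edmonds slack matrix** (odd-cut rows AND the exact edge rows; the
degree equalities have zero slack): for every `ε > 0` and even `n ≥ 4` there is a matrix `S̃` on
`(odd sets ⊔ edges) × (perfect matchings)` of psd rank `≤ 2^{(10⁴+1)·n^{1/2+ε}(log n)²}` whose odd-cut
block is an `(ε,n)`-admissible perturbation of `S` and whose edge block EQUALS that of
`PMPolytopeDim.pmFullSlack n` ("`S̃_{xy} = S_{xy}` for all other entries").
[cite: KaniewskiLeeDewolf2015, Thm. 19 (p. 12)] -/
theorem KaniewskiLeeDewolf2015_thm19_full :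
    ∀ ε : ℝ, 0 < ε → ∃ C : ℝ, ∃ n₀ : ℕ, ∀ n : ℕ, n₀ ≤ n → Even n →
      ∃ (r : ℕ) (St : OddSet n ⊕ Edge n → PMatch n → ℝ),
        (r : ℝ) ≤ (2 : ℝ) ^ (C * (n : ℝ) ^ (1 / 2 + ε) * Real.log n ^ 2) ∧
        HasPsdFactorization St r ∧
        IsKLWPerturbation n ε (fun U M => St (Sum.inl U) M) ∧
        ∀ (e : Edge n) (M : PMatch n),
          St (Sum.inr e) M = Literature.Combinatorics.Optimization.PMPolytopeDim.pmFullSlack n (Sum.inr e) M := by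
  intro ε hε
  refine ⟨10000 + 1, 4, fun n hn4 hn => ⟨KLWApprox.size n ε + Fintype.card (Edge n),
    KLWApprox.approxFull n ε, ?_, ?_, KLWApprox.isKLWPerturbation_approx hn ε, fun e M => rfl⟩⟩
  · -- size: `size + |E| ≤ 2^{X} + 2^{X} = 2^{X+1} ≤ 2^{X + X}`, `X = 10⁴ n^{1/2+ε} log² n ≥ 1`
    set X : ℝ := (10000 : ℝ) * (n : ℝ) ^ (1 / 2 + ε) * Real.log n ^ 2 with hX
    have h1 : (KLWApprox.size n ε : ℝ) ≤ 2 ^ X := KLWApprox.size_le hn4 hn hε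
    have h2 : ((Fintype.card (Edge n) : ℕ) : ℝ) ≤ 2 ^ X :=
      le_trans (by exact_mod_cast KLWApprox.card_edge_le n) (KLWApprox.sq_le_two_rpow hn4 hε)
    have hn1 : (1 : ℝ) < n := by exact_mod_cast (show 1 < n by omega)
    have hlogn1 : 1 ≤ Real.log n := by
      rw [← Real.log_exp 1]
      apply Real.log_le_log (Real.exp_pos 1)
      have : Real.exp 1 < 3 := by have := Real.exp_one_lt_d9; linarith
      linarith [(show (4 : ℝ) ≤ n by exact_mod_cast hn4)]
    have hnε : 1 ≤ (n : ℝ) ^ (1 / 2 + ε) := Real.one_le_rpow hn1.le (by linarith)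
    have hX1 : 1 ≤ X := by rw [hX]; nlinarith
    push_cast
    calc (KLWApprox.size n ε : ℝ) + (Fintype.card (Edge n) : ℝ) ≤ 2 ^ X + 2 ^ X := add_le_add h1 h2
      _ = (2 : ℝ) ^ (X + 1) := by rw [Real.rpow_add two_pos, Real.rpow_one]; ring
      _ ≤ (2 : ℝ) ^ ((10000 + 1) * (n : ℝ) ^ (1 / 2 + ε) * Real.log n ^ 2) := by
          refine Real.rpow_le_rpow_of_exponent_le one_le_two ?_
          rw [hX] at hX1 ⊢
          nlinarith
  · exact (KLWApprox.hasPsdFactorization_approx n ε).sumElim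
      (HasPsdFactorization.of_entry_nonneg_card_rows fun e M => by
        rw [Literature.Combinatorics.Optimization.PMPolytopeDim.pmVec_apply]; split_ifs <;> norm_num)

/-! ### Theorem 21 as a statement on the cube `{0,1}^m` -/

namespace KLWApprox

open GroverPolynomial in
/-- At weight `0` every run fails surely (`a_r(1) = 1`), so `F(0) = 0` ("If `z = 0^m` the algorithm
always outputs 0"). [cite: KaniewskiLeeDewolf2015, App. Thm. 21 (p. 14)] -/
theorem F_zero (m ℓ L : ℕ) : F m ℓ L 0 = 0 := by
  have ha : ∀ r : ℕ, (a r).eval 1 = 1 := fun r => by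
    have h := cos_odd_mul r 0
    simp only [mul_zero, Real.cos_zero, one_pow, one_mul] at h
    exact h.symm
  have hprod : prodFail m ℓ L 0 = 1 := by
    unfold prodFail failAt fail
    refine Finset.prod_eq_one fun i _ => ?_
    rw [zero_div, sub_zero, ha, one_pow, mul_one]
  unfold F; rw [hprod]; ring

/-- The weight of `z` over all coordinates is its Hamming weight `|z|`. [cite: KaniewskiLeeDewolf2015, App. (p. 14: "The number of solutions is the Hamming weight of the input, denoted |z|")] -/
theorem wt_univ_eq_card {m : ℕ} (z : Fin m → Bool) :
    wt Finset.univ z = ((Finset.univ.filter fun i => z i).card : ℝ) := wt_eq_card_filter _ _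

/-- **Kaniewski–Lee–de Wolf 2015, Theorem 21 — PROVED** (cube form, `QE` read as `deg_sos` by their
Theorem 12), verbatim (p. 14): "For every `ε > 0` there exists a function `f : {0,1}^m → ℝ_+` satisfying
`QE(f) = O(m^{1/2+ε} log m)` and: `f(0^m) = 0`. If `|z| ∈ {1,…,ℓ}` then `f(z) = |z| − 1`. If `|z| > ℓ`
then `|z| − 1 − 2^{−m^{2ε}} ≤ f(z) ≤ |z| − 1`" (`ℓ = m^{2ε}`).  Typed: `f = F(|z|)` has an sos
certificate with squares of degree `≤ d ≤ 2400·m^{1/2+ε}(log m + 1)` (the `+1` covers `m = 1`).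
[cite: KaniewskiLeeDewolf2015, App. Thm. 21 (p. 14)] -/
theorem KaniewskiLeeDewolf2015_thm21 {ε : ℝ} (hε : 0 < ε) :
    ∃ C : ℝ, ∀ m : ℕ, 1 ≤ m →
      ∃ (d : ℕ) (f : (Fin m → Bool) → ℝ), HasSosCertificate (2 * d) f ∧
        (d : ℝ) ≤ C * (m : ℝ) ^ (1 / 2 + ε) * (Real.log m + 1) ∧
        f (fun _ => false) = 0 ∧
        (∀ z, 1 ≤ wt Finset.univ z → wt Finset.univ z ≤ (m : ℝ) ^ (2 * ε) →
          f z = wt Finset.univ z - 1) ∧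
        (∀ z, (m : ℝ) ^ (2 * ε) < wt Finset.univ z →
          wt Finset.univ z - 1 - (2 : ℝ) ^ (-((m : ℝ) ^ (2 * ε))) ≤ f z ∧
            f z ≤ wt Finset.univ z - 1) := by
  refine ⟨2400, fun m hm => ?_⟩
  set ℓ := ell m ε with hℓ
  set L := logm m with hL
  refine ⟨halfDeg m ℓ L, fun z => F m ℓ L (wt Finset.univ z),
    hasSosCertificate_F m ℓ L Finset.univ (by simp), ?_, ?_, ?_, ?_⟩
  · -- degree: `1600 m^{1/2+ε}(L+1) ≤ 2400 m^{1/2+ε}(log m + 1)` as `L ≤ log₂ m ≤ (3/2) log m`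
    have h := halfDeg_le_rpow hm hε
    have hm0 : (0 : ℝ) < m := by exact_mod_cast hm
    have hlog0 : 0 ≤ Real.log m := Real.log_nonneg (by exact_mod_cast hm)
    have hL2 : (logm m : ℝ) ≤ Real.logb 2 m := by
      rw [Real.le_logb_iff_rpow_le one_lt_two hm0, Real.rpow_natCast]
      exact_mod_cast Nat.pow_log_le_self 2 (by omega : m ≠ 0)
    have hlog2 : Real.log 2 > 0.6931471803 := Real.log_two_gt_d9
    have hlogb : Real.logb 2 m ≤ 3 / 2 * Real.log m := by
      rw [Real.logb, div_le_iff₀ (by linarith)]; nlinarith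
    have hP : 0 ≤ (m : ℝ) ^ (1 / 2 + ε) := by positivity
    calc (halfDeg m ℓ L : ℝ) ≤ 1600 * (m : ℝ) ^ (1 / 2 + ε) * ((logm m : ℝ) + 1) := h
      _ ≤ 1600 * (m : ℝ) ^ (1 / 2 + ε) * (3 / 2 * Real.log m + 1) := by gcongr; linarith
      _ ≤ 2400 * (m : ℝ) ^ (1 / 2 + ε) * (Real.log m + 1) := by nlinarith
  · -- `f(0^m) = 0`
    have : wt Finset.univ (fun _ : Fin m => false) = 0 := by simp [wt, coordFn]
    simp only [this]
    exact F_zero m ℓ L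
  · -- exact regime
    intro z h1 hle
    show F m ℓ L (wt Finset.univ z) = wt Finset.univ z - 1
    set k := (Finset.univ.filter fun i => z i).card with hk
    have hwt : wt Finset.univ z = (k : ℝ) := wt_univ_eq_card z
    rw [hwt] at h1 hle ⊢
    have hk1 : 1 ≤ k := by exact_mod_cast h1
    have hkm : k ≤ m := by
      rw [hk]; exact (Finset.card_filter_le _ _).trans (by simp)
    have hkℓ : k ≤ ℓ := le_min (Nat.le_floor hle) hkm
    exact F_eq_of_le hk1 hkℓ
  · -- approximate regime
    intro z hlt
    show wt Finset.univ z - 1 - (2 : ℝ) ^ (-((m : ℝ) ^ (2 * ε))) ≤ F m ℓ L (wt Finset.univ z) ∧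
      F m ℓ L (wt Finset.univ z) ≤ wt Finset.univ z - 1
    set k := (Finset.univ.filter fun i => z i).card with hk
    have hwt : wt Finset.univ z = (k : ℝ) := wt_univ_eq_card z
    rw [hwt] at hlt ⊢
    have hkm : k ≤ m := by
      rw [hk]; exact (Finset.card_filter_le _ _).trans (by simp)
    have hpow0 : 0 ≤ (m : ℝ) ^ (2 * ε) := by positivity
    have hfl : ⌊(m : ℝ) ^ (2 * ε)⌋₊ < k := (Nat.floor_lt hpow0).2 hlt
    have hℓlt : ℓ < k := lt_of_le_of_lt (ell_le_floor m ε) hfl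
    have hℓeq : ℓ = ⌊(m : ℝ) ^ (2 * ε)⌋₊ := min_eq_left (by omega)
    have hk1' : ((ℓ : ℕ) : ℝ) + 1 ≤ (k : ℝ) := by exact_mod_cast hℓlt
    have hkm' : ((k : ℕ) : ℝ) ≤ m := by exact_mod_cast hkm
    have hlow := sub_le_F hk1' hkm' (lt_two_pow_logm m)
    have hup := F_le (m := m) (ℓ := ℓ) (L := L) (k := (k : ℝ)) (by linarith) hkm'
    refine ⟨le_trans ?_ hlow, hup⟩
    have hexp : (1 / 2 : ℝ) ^ (ℓ + 1) ≤ (2 : ℝ) ^ (-((m : ℝ) ^ (2 * ε))) := by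
      have hlt' : (m : ℝ) ^ (2 * ε) < (ℓ : ℝ) + 1 := by rw [hℓeq]; exact Nat.lt_floor_add_one _
      rw [_root_.one_div_pow, one_div, ← Real.rpow_natCast, ← Real.rpow_neg (by norm_num)]
      apply Real.rpow_le_rpow_of_exponent_le (by norm_num)
      push_cast; linarith
    linarith

end KLWApprox

end Literature.Barriers.PneNP

/-! ## Part F — the nonnegative-rank contrast (§RobustLP)

[KaniewskiLeeDewolf2015, §7.3 (p. 12)], right after Theorem 19: "This shows a big difference to the
case of nonnegative rank: Braun and Pokutta show that any `S̃` that is `O(1/n)`-close to `S` needs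
nonnegative rank `2^{Ω(n)}`."  For the admissible class of Theorem 19 itself (exact on the entries with
`|δ(U) ∩ M| ≤ (n/2)^{2ε}`, one-sided `2^{-(n/2)^{2ε}}`-close elsewhere) the `2^{Ω(n)}` NONNEGATIVE-rank
lower bound is Rothvoß's own argument [Rothvoss2017, Lemmas 5–6 (PDF p. 6)], which the tree proves on
the slot model (`rect_le`, `sum_Wmat_slack`, `hyperplane_separation_bound'`): the test matrix `W` is
supported on the entries with `|δ(U) ∩ M| ∈ {1, 3, k = 75}` (`Wmat_eq_zero_of_cut`), where admissible
`S̃` agree with `S` as soon as `(n/2)^{2ε} ≥ 75`, so `⟨W, S̃⟩ = ⟨W, S⟩ = 1`, every rectangle has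
`W`-weight `≤ 2θ = 2·2^{-δm}`, and each nonnegative rank-one summand of `S̃` is `≤ ‖S̃‖_∞` times a
fractional rectangle.  Results: `nonnegRank_slot` (slot model, any `S̃` exact on `|δ(U) ∩ M| ≤ 75` with
entries `≤ s`: `1 ≤ r·s·2θ`), `klwPerturbation_nonnegRank` / `_exp` (admissible `S̃` at slot sizes
`n = 216m + 150`: `1 ≤ r (t−1) 2θ`, `2^{δm} ≤ 2nr`), the padding `K_n ⊆ K_{n+2d}` under which
admissibility and nonnegative factorisations restrict (`padRow`, `padCol`, `cc_pad`,
`isKLWPerturbation_pad`), and `klwPerturbation_nonnegRank_all`: an absolute `c > 0` (`= δ/432`) with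
`rk₊(S̃) ≥ 2^{cn}` for every `ε > 0`, every large even `n` and every `(ε,n)`-admissible `S̃` — against
`rk_psd(S̃) ≤ 2^{10⁴ n^{1/2+ε} log² n}` for the `S̃` of `KaniewskiLeeDewolf2015_thm19_holds`.  (Braun–Pokutta's
theorem for uniformly `O(1/n)`-close `S̃` [BraunPokutta2014] is a different statement and is not
formalised here.)
-/

namespace Literature.Barriers.PneNP

open Finset
open Literature.Combinatorics.Optimization (HasNonnegFactorization)
open Literature.Combinatorics.SimpleGraph.CycleSpace (Crosses crosses_mk)

namespace KLWApprox


/-! ### §RobustLP — the nonnegative-rank contrast -/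

variable {m : ℕ}

/-- **Support of Rothvoß's weight matrix**: `W_{UM} ≠ 0` only if `|δ(U) ∩ M| ∈ {1, 3, q + 3}`
(the penalty lives on `Q₁`, the `μ₃`-kernel on pairs with `|δ(U) ∩ M| = |H| = 3`, the `μ_k`-kernel on
pairs with `|δ(U) ∩ M| = |F| = k = q + 3`). [cite: Rothvoss2017, §2 and §3.2 (PDF pp. 6, 8–9)] -/
theorem Wmat_eq_zero_of_cut {q μ : ℕ} (U : Finset (Slot m q)) (M : Finset (Sym2 (Slot m q)))
    (h1 : (M.filter fun e => cutCount U e = 1).card ≠ 1)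
    (h3 : (M.filter fun e => cutCount U e = 1).card ≠ 3)
    (hK : (M.filter fun e => cutCount U e = 1).card ≠ q + 3) :
    Wmat q μ U M = 0 := by
  have hg3 : ∀ π : Equiv.Perm (Slot m q), g3 μ π U M = 0 := by
    intro π
    unfold g3
    by_cases hU : U ∈ Uex3 μ π
    · by_cases hM : M ∈ Mex3 π
      · exact absurd (by rw [cut_eq_H hU hM, card_Hm]) h3
      · simp [hM]
    · simp [hU]
  have hgK : ∀ π : Equiv.Perm (Slot m q), gK μ π U M = 0 := by
    intro π
    unfold gK
    by_cases hU : U ∈ UexC μ π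
    · by_cases hM : M ∈ MexF π
      · exact absurd (by rw [cut_eq_F hU hM, card_Fm]) hK
      · simp [hM]
    · simp [hU]
  unfold Wmat kern3 kernK
  simp [hg3, hgK, h1]

/-- **Rothvoß's bound is robust on the slot model.** For `m = 2μ + 1` large (the largeness hypotheses
of `pm_bound`), `q = 72`, `t = (μ+1)q + 3`, `θ = 2^{-δm}`: every matrix `S̃` on (`t`-cuts) ×
(perfect matchings of the slot type) that AGREES with the odd-cut slack `|δ(U) ∩ M| − 1` on the entries
with `|δ(U) ∩ M| ≤ q + 3` and has entries `≤ s` satisfies `1 ≤ r · s · 2θ` for every nonnegative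
factorisation of size `r` — because `⟨W, S̃⟩ = ⟨W, S⟩ = 1` (`W` is supported where `S̃ = S`) while
every rectangle has `W`-weight `≤ 2θ` (Lemma 6) and each nonnegative rank-one term is `‖·‖_∞` times
a fractional rectangle (Lemma 5). [cite: Rothvoss2017, Lemmas 5–6 and eq. (2) (PDF p. 6)] -/
theorem nonnegRank_slot (μ : ℕ) (hm : m = 2 * μ + 1)
    (hU1 : (64 / cU εR) ^ 2 ≤ (m : ℝ) + 1) (hU2 : 32 / cU εR ≤ (m : ℝ) + 1)
    (hM1 : 16 * FQ * Real.log QB / cM qR εR ≤ (m : ℝ))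
    (St : {U : Finset (Slot m qR) // U.card = tCut qR μ} →
      {M : Finset (Sym2 (Slot m qR)) // IsPMOn univ M} → ℝ)
    (hagree : ∀ a b, (b.1.filter fun e => cutCount a.1 e = 1).card ≤ qR + 3 →
      St a b = ((b.1.filter fun e => cutCount a.1 e = 1).card : ℝ) - 1)
    {s : ℝ} (hs0 : 0 ≤ s) (hle : ∀ a b, St a b ≤ s)
    {r : ℕ} (hr : HasNonnegFactorization St r) :
    1 ≤ r * (s * (2 * θR m)) := by
  have hq : 0 < qR := by unfold qR; norm_num
  have hqe : Even qR := by unfold qR; decide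
  have hε : (0 : ℝ) < εR := by unfold εR; norm_num
  obtain ⟨Uf, Vf, hU, hV, hfac⟩ := hr
  have hWS : ∀ (a : {U : Finset (Slot m qR) // U.card = tCut qR μ})
      (b : {M : Finset (Sym2 (Slot m qR)) // IsPMOn univ M}),
      Wmat qR μ a.1 b.1 * St a b =
        Wmat qR μ a.1 b.1 * (((b.1.filter fun e => cutCount a.1 e = 1).card : ℝ) - 1) := by
    intro a b
    by_cases hc : (b.1.filter fun e => cutCount a.1 e = 1).card ≤ qR + 3
    · rw [hagree a b hc]
    · rw [Wmat_eq_zero_of_cut a.1 b.1 (by omega) (by omega) (by omega), zero_mul, zero_mul]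
  have hone : ∑ a, ∑ b, Wmat qR μ a.1 b.1 * ∑ l, Uf a l * Vf l b = 1 := by
    rw [← sum_Wmat_slack (m := m) (μ := μ) hq hqe hm]
    refine sum_congr rfl fun a _ => sum_congr rfl fun b _ => ?_
    rw [← hfac a b]
    exact hWS a b
  have key := hyperplane_separation_bound' (I := Fin r) Uf (fun b l => Vf l b) hU (fun b l => hV l b)
    (fun a b => Wmat qR μ a.1 b.1) (α := 2 * θR m) (s := s) hs0
    (fun a b => by
      show ∑ l, Uf a l * Vf l b ≤ s
      rw [← hfac a b]
      exact hle a b)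
    (fun X Y _ => by
      have := rect_le μ εR (θR m) (X.map (Function.Embedding.subtype _))
        (Y.map (Function.Embedding.subtype _)) hq hqe hm hε (θR_pos m) (θR_le_one m)
        (betaU_ok μ hm hU1 hU2) (betaM_ok hM1) hk_num
      simpa only [sum_map, Function.Embedding.coe_subtype] using this)
  have key' : ∑ a, ∑ b, Wmat qR μ a.1 b.1 * ∑ l, Uf a l * Vf l b ≤ 2 * θR m * s * r := by
    simpa only [Fintype.card_fin] using key
  rw [hone] at key'
  linarith

/-- A pair crosses `U` iff it has exactly one endpoint in `U`. [folklore] -/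
private theorem crosses_iff_cutCount {n : ℕ} (U : Finset (Fin n)) (e : Sym2 (Fin n)) :
    Crosses U e ↔ cutCount U e = 1 := by
  induction e using Sym2.ind with
  | h a b =>
    rw [crosses_mk, cutCount_mk]
    by_cases ha : a ∈ U <;> by_cases hb : b ∈ U <;> simp [ha, hb]

/-- `cc U M` in `cutCount` form. [folklore] -/
private theorem cc_eq_card_cut {n : ℕ} (U : OddSet n) (M : PMatch n) :
    cc U M = (M.1.filter fun e => cutCount U.1 e = 1).card := by
  unfold cc
  rw [Finset.filter_congr fun e (_ : e ∈ M.1) => crosses_iff_cutCount U.1 e]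

/-- The cut size `t = (μ+1)·q + 3` is odd for even `q`. [folklore] -/
private theorem odd_tCut (μ : ℕ) : Odd (tCut qR μ) := by
  unfold tCut qR
  exact Even.add_odd (Even.mul_left (by decide) _) (by decide)

/-- **KLW-admissible perturbations still need exponential NONNEGATIVE rank** (the contrast drawn in
[KaniewskiLeeDewolf2015, §7.3]: "any `S̃` that is `O(1/n)`-close to `S` needs nonnegative rank
`2^{Ω(n)}`", there credited to Braun–Pokutta; proved here for the `(ε, n)`-admissible class of
Theorem 19 itself, via Rothvoß's Lemmas 5–6).  At the slot sizes `n = |Slot m 72| = 216m + 150`,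
`m = 2μ+1` large, and once `(n/2)^{2ε} ≥ 75` (so that admissible `S̃` are EXACT on all entries with
`|δ(U) ∩ M| ≤ 75 = k`): every `(ε, n)`-admissible perturbation `S̃` of the odd-cut slack matrix with a
nonnegative factorisation of size `r` has `1 ≤ r · (t − 1) · 2θ`, `θ = 2^{-δm}` — the same inequality
`pm_bound` gives for extended formulations of `P_PM(n)`.
[cite: KaniewskiLeeDewolf2015, §7.3 (p. 12)] [cite: Rothvoss2017, Lemmas 5–6 (PDF p. 6)] -/
theorem klwPerturbation_nonnegRank (μ : ℕ) (hm : m = 2 * μ + 1)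
    (hU1 : (64 / cU εR) ^ 2 ≤ (m : ℝ) + 1) (hU2 : 32 / cU εR ≤ (m : ℝ) + 1)
    (hM1 : 16 * FQ * Real.log QB / cM qR εR ≤ (m : ℝ)) {n : ℕ} (e : Slot m qR ≃ Fin n) {ε : ℝ}
    (hε : ((qR : ℝ) + 3) ≤ ((n : ℝ) / 2) ^ (2 * ε))
    (St : OddSet n → PMatch n → ℝ) (hSt : IsKLWPerturbation n ε St)
    {r : ℕ} (hr : HasNonnegFactorization St r) :
    1 ≤ r * ((((tCut qR μ - 1 : ℕ)) : ℝ) * (2 * θR m)) := by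
  classical
  have hto : Odd (tCut qR μ) := odd_tCut μ
  have ht1 : 1 ≤ tCut qR μ := hto.pos
  -- rows and columns of the slot model, read in `Fin n` through `e`
  let ρ : {U : Finset (Slot m qR) // U.card = tCut qR μ} → OddSet n := fun a =>
    ⟨(cutEquiv e (tCut qR μ) a).1, by rw [(cutEquiv e (tCut qR μ) a).2]; exact hto⟩
  let γ : {M : Finset (Sym2 (Slot m qR)) // IsPMOn univ M} → PMatch n := fun b => pmEquiv e b
  have hcc : ∀ (a : {U : Finset (Slot m qR) // U.card = tCut qR μ})
      (b : {M : Finset (Sym2 (Slot m qR)) // IsPMOn univ M}),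
      cc (ρ a) (γ b) = (b.1.filter fun f => cutCount a.1 f = 1).card := by
    intro a b
    rw [cc_eq_card_cut]
    exact card_cut_equiv e (tCut qR μ) a b
  have hcut_le : ∀ (a : {U : Finset (Slot m qR) // U.card = tCut qR μ})
      (b : {M : Finset (Sym2 (Slot m qR)) // IsPMOn univ M}),
      (b.1.filter fun f => cutCount a.1 f = 1).card ≤ tCut qR μ := by
    intro a b
    have := b.2.card_cut_le (subset_univ a.1)
    rwa [a.2] at this
  obtain ⟨Uf, Vf, hU, hV, hfac⟩ := hr
  have hcast : (((tCut qR μ - 1 : ℕ)) : ℝ) = (tCut qR μ : ℝ) - 1 := by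
    rw [Nat.cast_sub ht1, Nat.cast_one]
  refine nonnegRank_slot μ hm hU1 hU2 hM1 (fun a b => St (ρ a) (γ b)) ?_ (by positivity) ?_
    ⟨fun a l => Uf (ρ a) l, fun l b => Vf l (γ b), fun a l => hU _ _, fun l b => hV _ _,
      fun a b => hfac (ρ a) (γ b)⟩
  · intro a b hc
    have h1 := (hSt (ρ a) (γ b)).1 (by
      rw [hcc]
      exact le_trans (by exact_mod_cast hc) hε)
    show St (ρ a) (γ b) = _
    rw [h1, pmOddCutSlack_apply, hcc]
  · intro a b
    have hle : St (ρ a) (γ b) ≤ pmOddCutSlack n (ρ a) (γ b) := by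
      by_cases h : (cc (ρ a) (γ b) : ℝ) ≤ ((n : ℝ) / 2) ^ (2 * ε)
      · exact ((hSt (ρ a) (γ b)).1 h).le
      · exact ((hSt (ρ a) (γ b)).2 (lt_of_not_ge h)).2
    rw [pmOddCutSlack_apply, hcc] at hle
    show St (ρ a) (γ b) ≤ _
    rw [hcast]
    have : (((b.1.filter fun f => cutCount a.1 f = 1).card : ℕ) : ℝ) ≤ tCut qR μ := by
      exact_mod_cast hcut_le a b
    linarith

/-- **Exponential form.** Under the same hypotheses, `2^{δm} ≤ 2 (t − 1) · r ≤ 2 n · r`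
(`θ · 2^{δm} = 1`, `t − 1 = 36m + 38 ≤ n = 216m + 150`): admissible perturbations have nonnegative rank
`≥ 2^{δm}/(2n) = 2^{Ω(n)}`, against psd rank `≤ 2^{O(n^{1/2+ε} log² n)}` (`KaniewskiLeeDewolf2015_thm19_holds`).
[cite: KaniewskiLeeDewolf2015, §7.3 (p. 12)] [cite: Rothvoss2017, Thm. 1, Lemmas 5–6 (PDF pp. 4–6)] -/
theorem klwPerturbation_nonnegRank_exp (μ : ℕ) (hm : m = 2 * μ + 1)
    (hU1 : (64 / cU εR) ^ 2 ≤ (m : ℝ) + 1) (hU2 : 32 / cU εR ≤ (m : ℝ) + 1)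
    (hM1 : 16 * FQ * Real.log QB / cM qR εR ≤ (m : ℝ)) {n : ℕ} (e : Slot m qR ≃ Fin n) {ε : ℝ}
    (hε : ((qR : ℝ) + 3) ≤ ((n : ℝ) / 2) ^ (2 * ε))
    (St : OddSet n → PMatch n → ℝ) (hSt : IsKLWPerturbation n ε St)
    {r : ℕ} (hr : HasNonnegFactorization St r) :
    (2 : ℝ) ^ (δR * m) ≤ 2 * (n : ℝ) * r := by
  have key := klwPerturbation_nonnegRank μ hm hU1 hU2 hM1 e hε St hSt hr
  have hθ := θR_mul_rpow m
  have hθ0 := θR_pos m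
  have hP : (0 : ℝ) < (2 : ℝ) ^ (δR * m) := Real.rpow_pos_of_pos (by norm_num) _
  have hn : Fintype.card (Slot m qR) = n := by rw [Fintype.card_congr e, Fintype.card_fin]
  have ht : (((tCut qR μ - 1 : ℕ)) : ℝ) ≤ (n : ℝ) := by
    have : tCut qR μ - 1 ≤ n := by
      rw [← hn, Slot.card]; unfold tCut qR; omega
    exact_mod_cast this
  have hr0 : (0 : ℝ) ≤ r := Nat.cast_nonneg r
  have h1 : 1 ≤ (r : ℝ) * ((n : ℝ) * (2 * θR m)) :=
    key.trans (mul_le_mul_of_nonneg_left (mul_le_mul_of_nonneg_right ht (by linarith)) hr0)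
  calc (2 : ℝ) ^ (δR * m) = 1 * (2 : ℝ) ^ (δR * m) := (one_mul _).symm
    _ ≤ ((r : ℝ) * ((n : ℝ) * (2 * θR m))) * (2 : ℝ) ^ (δR * m) :=
        mul_le_mul_of_nonneg_right h1 hP.le
    _ = 2 * (n : ℝ) * r * (θR m * (2 : ℝ) ^ (δR * m)) := by ring
    _ = 2 * (n : ℝ) * r := by rw [hθ, mul_one]

/-! #### Padding: the slack matrix of `K_n` is a submatrix of that of `K_{n+2d}` -/

section pad

variable (n d : ℕ)

/-- `Fin n ↪ Fin (n + 2d)`, the first `n` vertices. [folklore] -/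
private def padι : Fin n ↪ Fin (n + 2 * d) :=
  ⟨fun i => ⟨i.1, by omega⟩, fun i j h => Fin.ext (by simpa using congrArg Fin.val h)⟩

/-- Left endpoints `n + 2i` of the padding edges. [folklore] -/
private def padF (i : Fin d) : Fin (n + 2 * d) := ⟨n + 2 * i.1, by omega⟩

/-- Right endpoints `n + 2i + 1` of the padding edges. [folklore] -/
private def padG (i : Fin d) : Fin (n + 2 * d) := ⟨n + 2 * i.1 + 1, by omega⟩

/-- The padding matching `{n + 2i, n + 2i + 1}`, `i < d`, of the `2d` new vertices. [folklore] -/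
private def padMatching : Finset (Sym2 (Fin (n + 2 * d))) :=
  univ.image fun i : Fin d => s(padF n d i, padG n d i)

/-- `padF` is injective. [folklore] -/
private theorem padF_injective : Function.Injective (padF n d) := by
  intro i j h
  have := congrArg Fin.val h
  simp only [padF] at this
  exact Fin.ext (by omega)

/-- `padG` is injective. [folklore] -/
private theorem padG_injective : Function.Injective (padG n d) := by
  intro i j h
  have := congrArg Fin.val h
  simp only [padG] at this
  exact Fin.ext (by omega)

/-- Left and right endpoints differ. [folklore] -/
private theorem padF_ne_padG (i j : Fin d) : padF n d i ≠ padG n d j := by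
  intro h
  have := congrArg Fin.val h
  simp only [padF, padG] at this
  omega

/-- The padding matching is a perfect matching of the new vertices. [folklore] -/
private theorem isPMOn_padMatching :
    IsPMOn (univ.image (padF n d) ∪ univ.image (padG n d)) (padMatching n d) :=
  isPMOn_pairing _ _ (padF_injective n d) (padG_injective n d) (padF_ne_padG n d)

/-- Old and new vertices exhaust `Fin (n + 2d)`. [folklore] -/
private theorem pad_cover :
    univ.map (padι n d) ∪ (univ.image (padF n d) ∪ univ.image (padG n d)) = univ := by
  apply eq_univ_of_forall
  intro x
  simp only [mem_union, mem_map, mem_image, mem_univ, true_and]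
  by_cases hx : x.1 < n
  · exact Or.inl ⟨⟨x.1, hx⟩, Fin.ext rfl⟩
  · right
    obtain ⟨k, hk | hk⟩ := Nat.even_or_odd' (x.1 - n)
    · exact Or.inl ⟨⟨k, by omega⟩, Fin.ext (by simp only [padF]; omega)⟩
    · exact Or.inr ⟨⟨k, by omega⟩, Fin.ext (by simp only [padG]; omega)⟩

/-- Old and new vertices are disjoint. [folklore] -/
private theorem pad_disjoint :
    Disjoint (univ.map (padι n d)) (univ.image (padF n d) ∪ univ.image (padG n d)) := by
  rw [disjoint_left]
  intro x hx hx'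
  simp only [mem_map, mem_univ, true_and] at hx
  obtain ⟨i, rfl⟩ := hx
  simp only [mem_union, mem_image, mem_univ, true_and] at hx'
  rcases hx' with ⟨j, hj⟩ | ⟨j, hj⟩
  · have := congrArg Fin.val hj
    simp only [padF, padι] at this
    change n + 2 * j.1 = i.1 at this
    omega
  · have := congrArg Fin.val hj
    simp only [padG, padι] at this
    change n + 2 * j.1 + 1 = i.1 at this
    omega

variable {n d}

/-- An odd set of `K_n` read in `K_{n+2d}`. [folklore] -/
def padRow (U : OddSet n) : OddSet (n + 2 * d) :=
  ⟨U.1.map (padι n d), by rw [card_map]; exact U.2⟩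

/-- A perfect matching of `K_n` extended by the padding matching to one of `K_{n+2d}`. [folklore] -/
def padCol (M : PMatch n) : PMatch (n + 2 * d) :=
  ⟨M.1.image (Sym2.map (padι n d)) ∪ padMatching n d, by
    have h1 : IsPMOn (univ.map (padι n d)) (M.1.image (Sym2.map (padι n d))) := by
      rw [map_eq_image]
      exact M.2.image _ (padι n d).injective.injOn
    have h2 := h1.union (isPMOn_padMatching n d) (pad_disjoint n d)
    rwa [pad_cover] at h2⟩

/-- No padding edge crosses an old vertex set. [folklore] -/
private theorem filter_padMatching_crosses (U : OddSet n) :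
    (padMatching n d).filter (Crosses (padRow U : OddSet (n + 2 * d)).1) = ∅ := by
  rw [filter_eq_empty_iff]
  intro e he
  simp only [padMatching, mem_image, mem_univ, true_and] at he
  obtain ⟨i, rfl⟩ := he
  have hF : padF n d i ∉ (padRow U : OddSet (n + 2 * d)).1 := by
    intro h
    simp only [padRow, mem_map] at h
    obtain ⟨j, -, hj⟩ := h
    have := congrArg Fin.val hj
    change j.1 = n + 2 * i.1 at this
    omega
  have hG : padG n d i ∉ (padRow U : OddSet (n + 2 * d)).1 := by
    intro h
    simp only [padRow, mem_map] at h
    obtain ⟨j, -, hj⟩ := h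
    have := congrArg Fin.val hj
    change j.1 = n + 2 * i.1 + 1 at this
    omega
  rw [crosses_mk]
  tauto

/-- **Padding preserves the crossing number**: `|δ(U) ∩ (M ∪ M₀)| = |δ(U) ∩ M|` for the perfect
matching `M ∪ M₀` of `K_{n+2d}` extending `M` by a perfect matching `M₀` of the new vertices (the slack
matrix of `P_PM(n)` is a submatrix of that of `P_PM(n+2d)`). [cite: Rothvoss2017, §2 (PDF p. 5)] -/
theorem cc_pad (U : OddSet n) (M : PMatch n) :
    cc (padRow U : OddSet (n + 2 * d)) (padCol M) = cc U M := by
  unfold cc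
  simp only [padCol]
  rw [filter_union, filter_padMatching_crosses, union_empty,
    Finset.filter_congr fun e (_ : e ∈ M.1.image (Sym2.map (padι n d))) =>
      crosses_iff_cutCount (padRow U : OddSet (n + 2 * d)).1 e,
    Finset.filter_congr fun e (_ : e ∈ M.1) => crosses_iff_cutCount U.1 e]
  exact card_cut_image (padι n d) U.1 M.1

/-- Padding preserves the slack entry. [folklore] -/
private theorem pmOddCutSlack_pad (U : OddSet n) (M : PMatch n) :
    pmOddCutSlack (n + 2 * d) (padRow U) (padCol M) = pmOddCutSlack n U M := by
  rw [pmOddCutSlack_apply, pmOddCutSlack_apply, cc_pad]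

/-- **An admissible perturbation of the slack matrix of `K_{n+2d}` restricts to one of `K_n`**
(`ε ≥ 0`: the exactness threshold `(n/2)^{2ε}` and the precision `2^{-(n/2)^{2ε}}` are monotone in
`n`). [cite: KaniewskiLeeDewolf2015, Thm. 19 (p. 12)] -/
theorem isKLWPerturbation_pad {ε : ℝ} (hε : 0 ≤ ε)
    {St : OddSet (n + 2 * d) → PMatch (n + 2 * d) → ℝ} (h : IsKLWPerturbation (n + 2 * d) ε St) :
    IsKLWPerturbation n ε (fun U M => St (padRow U) (padCol M)) := by
  intro U M
  have hτ : ((n : ℝ) / 2) ^ (2 * ε) ≤ ((((n + 2 * d : ℕ)) : ℝ) / 2) ^ (2 * ε) := by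
    apply Real.rpow_le_rpow (by positivity) _ (by linarith)
    push_cast
    linarith [(Nat.cast_nonneg d : (0 : ℝ) ≤ d)]
  have hδ : (2 : ℝ) ^ (-((((n + 2 * d : ℕ)) : ℝ) / 2) ^ (2 * ε)) ≤ (2 : ℝ) ^ (-(((n : ℝ) / 2) ^ (2 * ε))) :=
    Real.rpow_le_rpow_of_exponent_le (by norm_num) (by linarith)
  have hU := h (padRow U) (padCol M)
  rw [cc_pad, pmOddCutSlack_pad] at hU
  refine ⟨fun hc => hU.1 (hc.trans hτ), fun hc => ?_⟩
  show _ ≤ St (padRow U) (padCol M) ∧ St (padRow U) (padCol M) ≤ _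
  by_cases hc' : (cc U M : ℝ) ≤ ((((n + 2 * d : ℕ)) : ℝ) / 2) ^ (2 * ε)
  · rw [hU.1 hc']
    exact ⟨by linarith [Real.rpow_pos_of_pos (show (0:ℝ) < 2 by norm_num) (-(((n : ℝ) / 2) ^ (2 * ε)))], le_rfl⟩
  · have h2 := hU.2 (lt_of_not_ge hc')
    exact ⟨by linarith [h2.1], h2.2⟩

/-- A nonnegative factorisation restricts to the padded submatrix. [folklore] -/
private theorem hasNonnegFactorization_pad {St : OddSet (n + 2 * d) → PMatch (n + 2 * d) → ℝ} {r : ℕ}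
    (h : HasNonnegFactorization St r) :
    HasNonnegFactorization (fun (U : OddSet n) (M : PMatch n) => St (padRow U) (padCol (d := d) M)) r := by
  obtain ⟨Uf, Vf, hU, hV, hfac⟩ := h
  exact ⟨fun a l => Uf (padRow a) l, fun l b => Vf l (padCol b), fun a l => hU _ _, fun l b => hV _ _,
    fun a b => hfac _ _⟩

end pad

/-! #### The contrast for all large even `n` -/

/-- The padded core: `m = 2μ+1` large, `n = 216m + 150 + 2d`; an admissible `S̃` on `K_n` restricted to
`K_{216m+150}` (slot size) is admissible there, so `2^{δm} ≤ 2 (216m + 150) r`. [folklore] -/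
private theorem contrast_core (μ d : ℕ)
    (hU1 : (64 / cU εR) ^ 2 ≤ ((2 * μ + 1 : ℕ) : ℝ) + 1) (hU2 : 32 / cU εR ≤ ((2 * μ + 1 : ℕ) : ℝ) + 1)
    (hM1 : 16 * FQ * Real.log QB / cM qR εR ≤ ((2 * μ + 1 : ℕ) : ℝ)) {ε : ℝ} (hε0 : 0 ≤ ε)
    (hε : ((qR : ℝ) + 3) ≤ ((((216 * (2 * μ + 1) + 150 : ℕ)) : ℝ) / 2) ^ (2 * ε))
    (St : OddSet (216 * (2 * μ + 1) + 150 + 2 * d) → PMatch (216 * (2 * μ + 1) + 150 + 2 * d) → ℝ)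
    (hSt : IsKLWPerturbation (216 * (2 * μ + 1) + 150 + 2 * d) ε St)
    {r : ℕ} (hr : HasNonnegFactorization St r) :
    (2 : ℝ) ^ (δR * ((2 * μ + 1 : ℕ) : ℝ)) ≤ 2 * ((((216 * (2 * μ + 1) + 150 : ℕ)) : ℝ)) * r := by
  have e : Slot (2 * μ + 1) qR ≃ Fin (216 * (2 * μ + 1) + 150) :=
    Fintype.equivFinOfCardEq (by rw [Slot.card]; unfold qR; ring)
  exact klwPerturbation_nonnegRank_exp (m := 2 * μ + 1) μ rfl hU1 hU2 hM1 e hε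
    (fun U M => St (padRow U) (padCol M)) (isKLWPerturbation_pad hε0 hSt) (hasNonnegFactorization_pad hr)

/-- **The LP/SDP contrast of [KaniewskiLeeDewolf2015, §7.3], for all large even `n`.** There is an
absolute constant `c > 0` (`c = δ/432`, `δ = δR` Rothvoß's constant) such that for every `ε > 0` and
every large even `n`, EVERY `(ε, n)`-admissible perturbation `S̃` of the odd-cut slack matrix of `K_n`
(`S̃ = S` where `|δ(U) ∩ M| ≤ (n/2)^{2ε}`, `S − 2^{−(n/2)^{2ε}} ≤ S̃ ≤ S` elsewhere) has NONNEGATIVE rank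
`≥ 2^{c n}` — whereas SOME admissible `S̃` has psd rank `≤ 2^{C_ε n^{1/2+ε} (log n)²}`
(`KaniewskiLeeDewolf2015_thm19_holds`).  KLW state the contrast citing Braun–Pokutta's theorem for
the (different, uniform) class of `O(1/n)`-close `S̃`; the present statement, for the class of
Theorem 19 itself, is Rothvoß's argument verbatim: his test matrix `W` is supported on entries with
`|δ(U) ∩ M| ∈ {1, 3, 75}`, where admissible `S̃` are exact, so `⟨W, S̃⟩ = ⟨W, S⟩ = 1`, and Lemmas 5–6
bound `⟨W, S̃⟩ ≤ rk₊(S̃) · ‖S̃‖_∞ · 2^{−δm}` (padding `K_{216m+150} ⊆ K_n` for the intermediate `n`).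
[cite: KaniewskiLeeDewolf2015, §7.3 (p. 12)] [cite: Rothvoss2017, Thm. 1, Lemmas 5–6 (PDF pp. 4–6)] -/
theorem klwPerturbation_nonnegRank_all :
    ∃ c : ℝ, 0 < c ∧ ∀ ε : ℝ, 0 < ε → ∃ n₀ : ℕ, ∀ n : ℕ, n₀ ≤ n → Even n →
      ∀ St : OddSet n → PMatch n → ℝ, IsKLWPerturbation n ε St →
        ∀ r : ℕ, HasNonnegFactorization St r → (2 : ℝ) ^ (c * n) ≤ r := by
  have hδ := δR_pos
  refine ⟨δR / 432, by positivity, fun ε hε => ?_⟩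
  -- thresholds
  set C : ℝ := δR * 580 / 216 with hC
  obtain ⟨N₁, hN₁⟩ := Filter.eventually_atTop.1
    (eventually_two_mul_sq_le_two_rpow (c := δR / 432) (by positivity) C)
  set T : ℝ := max (max (216 * ((64 / cU εR) ^ 2) + 582) (216 * (32 / cU εR) + 582))
    (max (216 * (16 * FQ * Real.log QB / cM qR εR) + 582) (2 * (75 : ℝ) ^ (1 / (2 * ε)) + 432)) with hT
  refine ⟨max N₁ ⌈T⌉₊, fun n hn hne St hSt r hr => ?_⟩
  have hnN₁ : N₁ ≤ n := le_of_max_le_left hn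
  have hnT : T ≤ (n : ℝ) := (Nat.le_ceil T).trans (by exact_mod_cast le_of_max_le_right hn)
  have hT1 : 216 * ((64 / cU εR) ^ 2) + 582 ≤ (n : ℝ) := le_trans (le_trans (le_max_left _ _) (le_max_left _ _)) hnT
  have hT2 : 216 * (32 / cU εR) + 582 ≤ (n : ℝ) := le_trans (le_trans (le_max_right _ _) (le_max_left _ _)) hnT
  have hT3 : 216 * (16 * FQ * Real.log QB / cM qR εR) + 582 ≤ (n : ℝ) :=
    le_trans (le_trans (le_max_left _ _) (le_max_right _ _)) hnT
  have hT4 : 2 * (75 : ℝ) ^ (1 / (2 * ε)) + 432 ≤ (n : ℝ) :=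
    le_trans (le_trans (le_max_right _ _) (le_max_right _ _)) hnT
  have h432 : 432 ≤ n := by
    have h0 : (0 : ℝ) ≤ 2 * (75 : ℝ) ^ (1 / (2 * ε)) := by positivity
    have : (432 : ℝ) ≤ n := by linarith
    exact_mod_cast this
  -- the parameters: `n = 216 m + 150 + 2 d`, `m = 2 μ + 1`, `d < 216`
  obtain ⟨μ, d, hd, hd216⟩ : ∃ μ d : ℕ, n = 216 * (2 * μ + 1) + 150 + 2 * d ∧ d < 216 := by
    obtain ⟨k, hk⟩ := hne
    exact ⟨(n - 366) / 432, (n - (432 * ((n - 366) / 432) + 366)) / 2, by omega, by omega⟩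
  subst hd
  have hnR : (((216 * (2 * μ + 1) + 150 + 2 * d : ℕ)) : ℝ) = 432 * μ + 366 + 2 * d := by push_cast; ring
  have hmR : (((2 * μ + 1 : ℕ)) : ℝ) = 2 * μ + 1 := by push_cast; ring
  have hslotR : (((216 * (2 * μ + 1) + 150 : ℕ)) : ℝ) = 432 * μ + 366 := by push_cast; ring
  have hdR : (d : ℝ) ≤ 215 := by exact_mod_cast Nat.lt_succ_iff.1 hd216
  have hμ0 : (0 : ℝ) ≤ μ := Nat.cast_nonneg μ
  have hd0 : (0 : ℝ) ≤ d := Nat.cast_nonneg d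
  rw [hnR] at hT1 hT2 hT3 hT4
  -- largeness of `m = 2μ + 1`
  have hA1 : (64 / cU εR) ^ 2 ≤ (((2 * μ + 1 : ℕ)) : ℝ) + 1 := by rw [hmR]; linarith
  have hA2 : 32 / cU εR ≤ (((2 * μ + 1 : ℕ)) : ℝ) + 1 := by rw [hmR]; linarith
  have hA3 : 16 * FQ * Real.log QB / cM qR εR ≤ (((2 * μ + 1 : ℕ)) : ℝ) := by rw [hmR]; linarith
  -- the exactness threshold at the slot size `432μ + 366`
  have hε' : ((qR : ℝ) + 3) ≤ ((((216 * (2 * μ + 1) + 150 : ℕ)) : ℝ) / 2) ^ (2 * ε) := by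
    have hx : (75 : ℝ) ^ (1 / (2 * ε)) ≤ (((216 * (2 * μ + 1) + 150 : ℕ) : ℝ)) / 2 := by
      rw [hslotR]; linarith
    have h75 : (75 : ℝ) = ((75 : ℝ) ^ (1 / (2 * ε))) ^ (2 * ε) := by
      rw [← Real.rpow_mul (by norm_num), one_div, inv_mul_cancel₀ (by positivity), Real.rpow_one]
    have hq : (qR : ℝ) + 3 = 75 := by unfold qR; norm_num
    rw [hq, h75]
    exact Real.rpow_le_rpow (by positivity) hx (by linarith)
  -- the slot bound on the restriction to `K_{432μ+366}`
  have key := contrast_core μ d hA1 hA2 hA3 hε.le hε' St hSt hr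
  rw [hmR, hslotR] at key
  -- arithmetic: `2^{cN} · 2N ≤ 2^{cN} · 2^{cN − C} ≤ 2^{δ m} ≤ 2 (432μ+366) r ≤ 2 N r`
  rw [hnR]
  set N : ℝ := 432 * μ + 366 + 2 * d with hN
  have hN1 : (1 : ℝ) ≤ N := by rw [hN]; linarith
  have hsq : 2 * N ^ 2 ≤ (2 : ℝ) ^ (δR / 432 * N - C) := by
    have := hN₁ _ hnN₁
    rwa [hnR] at this
  have hNle : 2 * N ≤ 2 * N ^ 2 := by nlinarith
  have hexp : (2 : ℝ) ^ (δR / 432 * N) * (2 : ℝ) ^ (δR / 432 * N - C) ≤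
      (2 : ℝ) ^ (δR * (2 * (μ : ℝ) + 1)) := by
    rw [← Real.rpow_add (by norm_num)]
    apply Real.rpow_le_rpow_of_exponent_le (by norm_num)
    have h1 := mul_le_mul_of_nonneg_left hdR hδ.le
    rw [hC, hN]
    linarith
  have hr0 : (0 : ℝ) ≤ r := Nat.cast_nonneg r
  have hkey' : (2 : ℝ) ^ (δR * (2 * (μ : ℝ) + 1)) ≤ 2 * N * r := by
    refine key.trans (mul_le_mul_of_nonneg_right ?_ hr0)
    rw [hN]
    linarith
  have hy0 : (0 : ℝ) ≤ (2 : ℝ) ^ (δR / 432 * N) := (Real.rpow_pos_of_pos (by norm_num) _).le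
  have hchain : (2 : ℝ) ^ (δR / 432 * N) * (2 * N) ≤ r * (2 * N) :=
    calc (2 : ℝ) ^ (δR / 432 * N) * (2 * N)
        ≤ (2 : ℝ) ^ (δR / 432 * N) * (2 : ℝ) ^ (δR / 432 * N - C) :=
          mul_le_mul_of_nonneg_left (hNle.trans hsq) hy0
      _ ≤ (2 : ℝ) ^ (δR * (2 * (μ : ℝ) + 1)) := hexp
      _ ≤ 2 * N * r := hkey'
      _ = r * (2 * N) := by ring
  exact le_of_mul_le_mul_right hchain (by linarith)

/-! #### The technique class on the LP side; the contrast in headline form -/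

/-- **Approximation-robust NONNEGATIVE-rank lower bound at `(ε, n)`** — the LP mirror of
`IsApproxRobustPsdBound`: `R` is certified by an argument insensitive to the perturbations (1)–(2) of
Theorem 19 iff EVERY `(ε, n)`-admissible perturbation `S̃` of the odd-cut slack matrix of `K_n` has
nonnegative rank `≥ R` (no nonnegative factorisation of size `< R`).  Rothvoß's hyperplane-separation
bound with his test matrix `W` is such an argument (`klwPerturbation_nonnegRank_all`).
[cite: KaniewskiLeeDewolf2015, §7.3 (p. 12)] -/
def IsApproxRobustNonnegBound (n : ℕ) (ε : ℝ) (R : ℕ) : Prop :=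
  ∀ St : OddSet n → PMatch n → ℝ, IsKLWPerturbation n ε St →
    ∀ r : ℕ, r < R → ¬HasNonnegFactorization St r

/-- A robust nonnegative-rank bound is at most the nonnegative rank of `S` itself (`S` is admissible).
[cite: KaniewskiLeeDewolf2015, §7.3 (p. 12)] -/
theorem IsApproxRobustNonnegBound.le_of_hasNonnegFactorization {n : ℕ} {ε : ℝ} {R r : ℕ}
    (h : IsApproxRobustNonnegBound n ε R) (hS : HasNonnegFactorization (pmOddCutSlack n) r) : R ≤ r := by
  by_contra hlt
  exact h _ (isKLWPerturbation_self n) r (lt_of_not_ge hlt) hS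

/-- **Floor for robust LP bounds.** There is an absolute `c > 0` such that for every `ε > 0` and all
large even `n`, `⌈2^{c n}⌉` IS an approximation-robust nonnegative-rank lower bound at `(ε, n)` — the
LP side of KLW's contrast ("Braun and Pokutta show that any `S̃` that is `O(1/n)`-close to `S` needs
nonnegative rank `2^{Ω(n)}`"), here for the admissible class of Theorem 19 via Rothvoß's Lemmas 5–6.
[cite: KaniewskiLeeDewolf2015, §7.3 (p. 12)] [cite: Rothvoss2017, Lemmas 5–6 (PDF p. 6)] -/
theorem approxRobustNonnegBound_floor :
    ∃ c : ℝ, 0 < c ∧ ∀ ε : ℝ, 0 < ε → ∃ n₀ : ℕ, ∀ n : ℕ, n₀ ≤ n → Even n →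
      IsApproxRobustNonnegBound n ε ⌈(2 : ℝ) ^ (c * n)⌉₊ := by
  obtain ⟨c, hc, H⟩ := klwPerturbation_nonnegRank_all
  refine ⟨c, hc, fun ε hε => ?_⟩
  obtain ⟨n₀, hn₀⟩ := H ε hε
  refine ⟨n₀, fun n hn he St hSt r hr hfac => ?_⟩
  have h1 := hn₀ n hn he St hSt r hfac
  have h2 : (r : ℝ) < (2 : ℝ) ^ (c * n) := Nat.lt_ceil.1 hr
  linarith

/-- **Kaniewski–Lee–de Wolf's LP/SDP contrast for the matching slack matrix, headline form.** There is
an absolute `c > 0` such that for every `ε > 0` there are `C, n₀` with, for every even `n ≥ n₀`: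
(LP) `⌈2^{cn}⌉` is an approximation-robust NONNEGATIVE-rank lower bound at `(ε, n)` — every admissible
`S̃` has `rk₊(S̃) ≥ 2^{cn}`; (SDP) every approximation-robust PSD-rank lower bound `R` at `(ε, n)` has
`R ≤ 2^{C n^{1/2+ε} (log n)²}` (Theorem 19, `approxRobustPsdBound_ceiling`).
[cite: KaniewskiLeeDewolf2015, Thm. 19 and §7.3 (p. 12)] [cite: Rothvoss2017, Thm. 1, Lemmas 5–6 (PDF pp. 4–6)] -/
theorem KaniewskiLeeDewolf2015_contrast :
    ∃ c : ℝ, 0 < c ∧ ∀ ε : ℝ, 0 < ε → ∃ C : ℝ, ∃ n₀ : ℕ, ∀ n : ℕ, n₀ ≤ n → Even n →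
      IsApproxRobustNonnegBound n ε ⌈(2 : ℝ) ^ (c * n)⌉₊ ∧
        ∀ R : ℕ, IsApproxRobustPsdBound n ε R →
          (R : ℝ) ≤ (2 : ℝ) ^ (C * (n : ℝ) ^ (1 / 2 + ε) * Real.log n ^ 2) := by
  obtain ⟨c, hc, H⟩ := approxRobustNonnegBound_floor
  refine ⟨c, hc, fun ε hε => ?_⟩
  obtain ⟨n₁, hn₁⟩ := H ε hε
  obtain ⟨C, n₂, hn₂⟩ := approxRobustPsdBound_ceiling hε
  exact ⟨C, max n₁ n₂, fun n hn he =>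
    ⟨hn₁ n (le_of_max_le_left hn) he, hn₂ n (le_of_max_le_right hn) he⟩⟩


end KLWApprox

end Literature.Barriers.PneNP

/-! ## Theorem 19 with the structure of `S̃` explicit: a level function of `|δ(U) ∩ M|` -/

namespace Literature.Barriers.PneNP

open Literature.Combinatorics.Optimization
open Literature.Combinatorics.Optimization.GroverSchedule

/-- **Theorem 19, level form.** The approximating matrix depends on the pair `(U, M)` only through the
crossing number: `S̃_{UM} = g(|δ(U) ∩ M|)` for ONE function `g : ℕ → ℝ` (here
`g(k) = F_{m,ℓ,L}(k) = (k − 1)(1 − Π fail)`, the expected payout of the Grover schedule; in print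
`S̃_{UM}` is the expected output of the algorithm for `g(z) = |z| − 1` run on `x_M`, a function of
`|x_M| = |δ(U) ∩ M|` alone).  So for every `ε > 0` there are `C, n₀` with: for every even `n ≥ n₀` some
LEVEL matrix `(U, M) ↦ g(|δ(U) ∩ M|)` is an `(ε, n)`-admissible perturbation of `S` of psd rank
`≤ 2^{C n^{1/2+ε} (log n)²}` — any lower-bound functional that is insensitive to replacing `S` by
admissible level matrices is capped accordingly. [cite: KaniewskiLeeDewolf2015, Thm. 19 and its proof (p. 12)] -/
theorem KaniewskiLeeDewolf2015_thm19_level {ε : ℝ} (hε : 0 < ε) :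
    ∃ C : ℝ, ∃ n₀ : ℕ, ∀ n : ℕ, n₀ ≤ n → Even n →
      ∃ (r : ℕ) (g : ℕ → ℝ), (r : ℝ) ≤ (2 : ℝ) ^ (C * (n : ℝ) ^ (1 / 2 + ε) * Real.log n ^ 2) ∧
        HasPsdFactorization (fun (U : OddSet n) (M : PMatch n) => g (cc U M)) r ∧
        IsKLWPerturbation n ε (fun U M => g (cc U M)) :=
  ⟨10000, 4, fun n hn4 hn => ⟨KLWApprox.size n ε,
    fun k => F (n / 2) (KLWApprox.ell (n / 2) ε) (KLWApprox.logm (n / 2)) k,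
    KLWApprox.size_le hn4 hn hε, KLWApprox.hasPsdFactorization_approx n ε,
    KLWApprox.isKLWPerturbation_approx hn ε⟩⟩

/-- Hence an **approximation-robust psd bound restricted to level perturbations** is capped too: if
`R` is such that every admissible `S̃` OF LEVEL FORM `g(|δ(U) ∩ M|)` has psd rank `≥ R`, then
`R ≤ 2^{C n^{1/2+ε}(log n)²}` for `n ≥ n₀` even. [cite: KaniewskiLeeDewolf2015, Thm. 19 (p. 12)] -/
theorem levelRobustPsdBound_ceiling {ε : ℝ} (hε : 0 < ε) :
    ∃ C : ℝ, ∃ n₀ : ℕ, ∀ n : ℕ, n₀ ≤ n → Even n → ∀ R : ℕ,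
      (∀ g : ℕ → ℝ, IsKLWPerturbation n ε (fun U M => g (cc U M)) →
        ∀ r : ℕ, r < R → ¬HasPsdFactorization (fun (U : OddSet n) (M : PMatch n) => g (cc U M)) r) →
      (R : ℝ) ≤ (2 : ℝ) ^ (C * (n : ℝ) ^ (1 / 2 + ε) * Real.log n ^ 2) := by
  obtain ⟨C, n₀, H⟩ := KaniewskiLeeDewolf2015_thm19_level hε
  refine ⟨C, n₀, fun n hn he R hR => ?_⟩
  obtain ⟨r, g, hr, hfac, hpert⟩ := H n hn he
  have hRr : R ≤ r := by
    by_contra hlt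
    exact hR g hpert r (lt_of_not_ge hlt) hfac
  exact le_trans (by exact_mod_cast hRr) hr

end Literature.Barriers.PneNP

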